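import Literature.NumberTheory.LFunctions.ZeroDensityInghamHuxleyProofs
import Literature.NumberTheory.LFunctions.ZeroDensityGuthMaynardRange
import HarnessLib

/-!
# Guth–Maynard's zero-density theorem on the window `7/10 ≤ σ ≤ 4/5` from their large values estimate

Topic `NumberTheory/LFunctions`, family RH; a leaf above `ZeroDensityGuthMaynardRange.lean` and
`ZeroDensityInghamHuxleyProofs.lean`. This file PROVES the deduction "Theorem 1.1 ⇒ Theorem 1.2"
of L. Guth and J. Maynard, *New large value estimates for Dirichlet polynomials*, Ann. of Math.
203 (2026), §13.1, and thereby reduces the tree's named fact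
`Literature.NumberTheory.LFunctions.zeroDensity_guth_maynard` (`ZeroCounting.lean`: Theorem 1.2,
`N(σ, T) ≪_ε T^{15(1−σ)/(3+5σ)+ε}` for `7/10 ≤ σ ≤ 1`) to Theorem 1.1 of the paper ALONE:

* `Literature.NumberTheory.LFunctions.zeroDensity_guth_maynard_of_largeValues (hLV) :
  zeroDensity_guth_maynard`,

where the hypothesis `hLV` is Theorem 1.1 as printed ("Suppose `(b_n)` is a sequence of complex
numbers with `|b_n| ≤ 1`, and `(t_r)_{r≤R}` is a sequence of `1`-separated points in `[0, T]` such
that `|∑_{n=N}^{2N} b_n n^{it_r}| ≥ V` for all `r ≤ R`. Then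
`R ≤ T^{o(1)}(N²V^{-2} + N^{18/5}V^{-4} + TN^{12/5}V^{-4})`"), with `T^{o(1)}` read according to
the paper's conventions (§1.2: for every `ε > 0` a constant `C(ε)` and all large `T`) and in the
range `N ≤ T` (the paper, §3: "Theorem 1.1 follows from (1.1) if `N ≥ T` … so we may assume
`N < T`"; longer polynomials are handled below by the mean value theorem). No definition and no
named fact is introduced; everything in this file is proved. Theorem 1.1 itself (§§3–12 of the
paper) is not in the tree.

On `[4/5, 1]` the fact is Huxley's theorem `N(σ, T) ≪ T^{3(1−σ)/(3σ−1)+ε}`, PROVED in the tree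
(`Ivic1985_theorem11_1_huxley_holds`), combined by `zeroDensity_guth_maynard_of_window`
(`ZeroDensityGuthMaynardRange.lean`); on `[1/2, 7/10]` Theorem 1.2 is Ingham's theorem
(`zeroDensityEstimate_guth_maynard_half_of_largeValues`).

## The argument (Guth–Maynard §13.1) in the tree's normalisation, and the deviations from it

Fix `7/10 ≤ σ ≤ 4/5`, `0 < η ≤ 1/100`, `T = 2U` large, `l = log T`, and a finite set of zeros
`ρ = β + iγ`, `β ≥ σ`, `U < γ ≤ 2U`, ordinates `≥ 300 l` apart (thinning costs `≪ l`,
`HuxleyZeroDensity.card_le_of_thinning`). Put `κ = 15(1−σ)/(3+5σ)`, `a₁ = 10/(6+10σ)`,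
`a₂ = 15/(6+10σ)`, `α = κ/(18/5 − 4σ)` (`GuthMaynardWindow.gm_exponents`).

* *Zero detection.* The paper's Type I/II zeros (with `b_n = (∑_{d|n, d ≤ 2T^{1/100}} μ(d)) e^{-n/√T}`
  and [MP] for the Type II count) are replaced by the tree's zero-detection dichotomy
  `HuxleyZeroDensity.zeroDetection_integral` with `X = T^η`, `Y = T^{1/2}`: class (i),
  `|∑_{X<n≤100lY} a_X(n)e^{-n/Y}n^{-ρ}| > 1/3`, or class (ii),
  `∫_{|y|≤100l} |ζ M_X(1/2+i(γ+y))| dy ≥ 2⁻²⁰(σ−1/2)Y^{σ−1/2}`. Class (ii) is counted by the fourth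
  moment of `ζ` on disjoint windows (`HuxleyIvic.classTwo_fourth_le`, `zetaFourthMomentWeak`):
  `≪ T^{1+O(η)}Y^{2−4σ} = T^{2−2σ+O(η)}`, and `2 − 2σ ≤ κ` for `σ ≤ 9/10`
  (`GuthMaynardWindow.classTwo_numeric_gm`) — the paper's "`≤ T^{2−2σ}(log T)^{O(1)}` by [MP]".
* *The power `k`* ((13.1): "`T^{10/(6+10σ)} ≤ N^k ≤ T^{15/(6+10σ)}` … if `N > T^{5/(6+10σ)}` we
  can take `k = 2`"). A class (i) zero has a dyadic block `(M, 2M]`, `T^η ≤ M ≤ T^{1/2+η/2}`, with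
  block sum `≥ 1/(3J)`; its `k`-th power, `T^{a₁} ≤ M^k ≤ 2^K T^{a₂+η}`
  (`GuthMaynardWindow.exists_power_gm`, `K = ⌈2/η⌉`), is a Dirichlet polynomial on
  `(M^k, (2M)^k]` with coefficients `≪ d(r)^{2k−1} ≪ T^{O(η)}` (`HuxleyIvic.pow_sum_eq_Ioc`,
  `HuxleyIvic.norm_powCoeff_le`), split into `k` dyadic sub-blocks `(P, 2P]`.
* *Removing the real parts.* The paper inserts a smooth `ψ(log n) = n^{σ−β}` and Fourier expands.
  Here instead `r^{-(β−σ)} = P^{-(β−σ)} e^{-θ log(r/P)}`, `θ = β − σ ∈ [0, 1/2]`, is Taylor expanded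
  to order `n ≍ log T` (`Real.exp_bound`): a large value `V` at `ρ` yields a large value `V/4` of
  one of the `n` polynomials `∑ c_r log^m(r/P) r^{-σ} r^{-iγ}` (`m < n`) at the REAL point `γ`
  (`GuthMaynardWindow.taylor_split`, `GuthMaynardWindow.taylor_pigeonhole`); the ordinates are
  `1`-separated points of `[0, T]`, and the loss is a factor `n ≪ log T`.
* *Counting* (`GuthMaynardWindow.block_count_gm`). Normalising the coefficients (`÷ T^{O(η)}P^{-σ}`,
  conjugating to pass from `r^{-it}` to `r^{it}`: `GuthMaynardWindow.realPoints_count_LV`), if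
  `P ≤ min(T, T^α)` the hypothesis `hLV` gives `≲ P^{2−2σ} + P^{18/5−4σ} + TP^{12/5−4σ} ≲ T^κ`
  (by `a₂(2−2σ) = κ`, `α(18/5−4σ) = κ`, `1 + a₁(12/5−4σ) = κ`); otherwise the discrete mean value
  theorem (`Gallagher.discreteMeanValue`, `GuthMaynardWindow.realPoints_count_MVT`) gives
  `≲ (P + T)P^{1−2σ} ≲ T^κ` (by `P^{2−2σ} ≲ T^κ` and, when `T^α < P < T`,
  `1 + α(1−2σ) ≤ κ`, the paper's `κ − (250(σ−3/4)²+3/8)/(2(3+5σ)(9−10σ))`).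
* Summing over blocks, powers, sub-blocks and Taylor terms (`GuthMaynardWindow.classOne_card_le_gm`),
  absorbing powers of `l` (`HuxleyIvic.log_pow_le`), thinning, and the counting layer of
  `ZeroDensityInghamTools` (`ZeroDensity.wellSpacedBound_of_eventually`, `count_dyadic_le`,
  `isBigO_of_dyadic`) give `N(σ, T) ≪_ε T^{κ+ε}` on the window.

## Main statements (all proved)

* `GuthMaynardWindow.taylor_split`, `GuthMaynardWindow.taylor_pigeonhole` — removal of the real part.
* `GuthMaynardWindow.realPoints_count_LV`, `GuthMaynardWindow.realPoints_count_MVT`,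
  `GuthMaynardWindow.block_count_gm` — the count on one block.
* `GuthMaynardWindow.dyadicPoly_card_le_gm`, `GuthMaynardWindow.classOne_card_le_gm` — class (i).
* `GuthMaynardWindow.gm_exponents`, `GuthMaynardWindow.exists_power_gm` — (13.1) and the exponents.
* `GuthMaynardWindow.card_sep_le_gm`, `GuthMaynardWindow.wellSpaced_gm` — the separated count.
* `isBigO_zetaZeroCountRe_window_of_largeValues` — Theorem 1.2 on `[7/10, 4/5]` from Theorem 1.1.
* `zeroDensity_guth_maynard_of_largeValues`, `zeroDensityEstimate_guth_maynard_half_of_largeValues`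
  — the named fact, and Theorem 1.2 on `[1/2, 1]`, from Theorem 1.1.

## References

* L. Guth, J. Maynard, *New large value estimates for Dirichlet polynomials*, Ann. of Math. (2)
  203 (2026), no. 2; arXiv:2405.20552 (2024): Theorem 1.1, Theorem 1.2, §1.2 (conventions),
  §3 (the reduction to `N < T`), §13.1 (proof of Theorem 1.2, display (13.1)).
* A. Ivić, *The Riemann Zeta-Function*, Wiley 1985, §11.2–§11.3 (the zero-detection method and the
  power trick behind `HuxleyIvic`).
* M. N. Huxley, *On the difference between consecutive primes*, Invent. Math. 15 (1972) 164–170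
  (the range `σ ≥ 4/5`, via `Ivic1985_theorem11_1_huxley_holds`).
* A. E. Ingham, *On the estimation of `N(σ, T)`*, Quart. J. Math. 11 (1940) 291–292 (the range
  `σ ≤ 7/10`, via `zeroDensity_ingham_holds`).
-/

noncomputable section

open Real Set Filter Topology Complex MeasureTheory Finset Asymptotics

namespace Literature.NumberTheory.LFunctions

namespace GuthMaynardWindow

open ZeroDetect (mollifier mollCoeff norm_mollCoeff_le norm_mollifier_le)
open HuxleyZeroDetection (smoothed norm_smoothed_le)
open HuxleyIvic (powCoeff pow_sum_eq_Ioc norm_powCoeff_le exists_block_ge classTwo_fourth_le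
  log_pow_le eventually_thresholds ten_le_rpow_quarter)

/-! ## §1. Removing the real part of the points: the Taylor expansion of `r^{-θ}` on a block -/

/-- For `r ∈ (P, 2P]`, `P ≥ 1`: `0 ≤ log(r/P) ≤ log 2`. [folklore] -/
theorem log_ratio_bounds {P r : ℕ} (hP : 1 ≤ P) (hr : r ∈ Finset.Ioc P (2 * P)) :
    0 ≤ Real.log ((r : ℝ) / P) ∧ Real.log ((r : ℝ) / P) ≤ Real.log 2 := by
  rw [Finset.mem_Ioc] at hr
  have hP0 : (0 : ℝ) < P := by exact_mod_cast hP
  have h1 : (1 : ℝ) ≤ (r : ℝ) / P := by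
    rw [le_div_iff₀ hP0, one_mul]; exact_mod_cast hr.1.le
  have h2 : (r : ℝ) / P ≤ 2 := by
    rw [div_le_iff₀ hP0]; exact_mod_cast hr.2
  exact ⟨Real.log_nonneg h1, Real.log_le_log (by linarith) h2⟩

/-- `‖r^{-it}‖ = 1` (`r ≥ 1`). [folklore] -/
theorem norm_natCast_cpow_neg_mul_I {r : ℕ} (hr : 0 < r) (t : ℝ) :
    ‖(r : ℂ) ^ (-((t : ℂ) * I))‖ = 1 := by
  rw [Complex.norm_natCast_cpow_of_pos hr]
  simp

/-- `‖r^{-σ}‖ = r^{-σ}` (`r ≥ 1`, `σ` real). [folklore] -/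
theorem norm_natCast_cpow_neg_ofReal {r : ℕ} (hr : 0 < r) (σ : ℝ) :
    ‖(r : ℂ) ^ (-(σ : ℂ))‖ = (r : ℝ) ^ (-σ) := by
  rw [Complex.norm_natCast_cpow_of_pos hr]
  simp

/-- **The factorisation of `r^{-ρ}` on the block `(P, 2P]`**: for `ρ = σ + θ + iγ`,
`r^{-ρ} = P^{-θ} · e^{-θ log(r/P)} · r^{-σ} · r^{-iγ}`. [folklore] -/
theorem natCast_cpow_neg_split {P r : ℕ} (hP : 1 ≤ P) (hr : 0 < r) (σ θ γ : ℝ) :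
    (r : ℂ) ^ (-((σ : ℂ) + θ + γ * I)) =
      ((((P : ℝ) ^ (-θ) * Real.exp (-(θ * Real.log ((r : ℝ) / P))) : ℝ) : ℂ) *
        ((r : ℂ) ^ (-(σ : ℂ)) * (r : ℂ) ^ (-((γ : ℂ) * I)))) := by
  have hr0 : (r : ℂ) ≠ 0 := by exact_mod_cast hr.ne'
  have hP0 : (0 : ℝ) < P := by exact_mod_cast hP
  have hrr : (0 : ℝ) < r := by exact_mod_cast hr
  have e1 : -((σ : ℂ) + θ + γ * I) = (-(θ : ℂ)) + ((-(σ : ℂ)) + (-((γ : ℂ) * I))) := by ring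
  rw [e1, Complex.cpow_add _ _ hr0, Complex.cpow_add _ _ hr0]
  congr 1
  -- `r^{-θ} = P^{-θ} e^{-θ log(r/P)}`
  have e2 : (r : ℂ) ^ (-(θ : ℂ)) = (((r : ℝ) ^ (-θ) : ℝ) : ℂ) := by
    rw [Complex.ofReal_cpow hrr.le, Complex.ofReal_natCast]
    push_cast
    ring_nf
  rw [e2]
  congr 1
  have e3 : (r : ℝ) = P * ((r : ℝ) / P) := by field_simp
  conv_lhs => rw [e3]
  rw [Real.mul_rpow hP0.le (by positivity)]
  congr 1
  rw [Real.rpow_def_of_pos (by positivity)]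
  congr 1
  ring

/-- **Taylor removal of the real part** (the step "we make a slight modification to `D` to remove
the dependencies on the real parts" of Guth–Maynard §13, done here with the Taylor expansion of
`e^{-θ log(r/P)}` instead of a smoothing): for `P ≥ 1`, `0 ≤ θ ≤ 1/2`, `n ≥ 1` and any
coefficients `c`,
`|∑_{P<r≤2P} c(r) r^{-(σ+θ+iγ)}| ≤ ∑_{m<n} (θ^m/m!) |D_m(γ)| + S (θ log 2)^n (n+1)/(n! n)`,
where `D_m(γ) = ∑_{P<r≤2P} c(r) log^m(r/P) r^{-σ} r^{-iγ}` and `S = ∑_{P<r≤2P} |c(r)| r^{-σ}`.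
[cite: GuthMaynard2026, Section 13, proof of Theorem 1.2] -/
theorem taylor_split {P : ℕ} (hP : 1 ≤ P) (c : ℕ → ℂ) (σ : ℝ) {θ : ℝ} (hθ0 : 0 ≤ θ)
    (hθ : θ ≤ 1 / 2) (γ : ℝ) {n : ℕ} (hn : 1 ≤ n) :
    ‖∑ r ∈ Finset.Ioc P (2 * P), c r * (r : ℂ) ^ (-((σ : ℂ) + θ + γ * I))‖ ≤
      (∑ m ∈ Finset.range n, θ ^ m / m.factorial *
        ‖∑ r ∈ Finset.Ioc P (2 * P), (c r * (((Real.log ((r : ℝ) / P)) ^ m : ℝ) : ℂ) *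
          (r : ℂ) ^ (-(σ : ℂ))) * (r : ℂ) ^ (-((γ : ℂ) * I))‖) +
      (∑ r ∈ Finset.Ioc P (2 * P), ‖c r‖ * (r : ℝ) ^ (-σ)) *
        ((θ * Real.log 2) ^ n * (((n : ℝ) + 1) / (n.factorial * n))) := by
  have hP0 : (0 : ℝ) < P := by exact_mod_cast hP
  have hlog2 : (0 : ℝ) < Real.log 2 := Real.log_pos (by norm_num)
  have hlog2' : Real.log 2 < 1 := by
    have := Real.log_two_lt_d9; linarith
  -- notation
  set x : ℕ → ℝ := fun r ↦ Real.log ((r : ℝ) / P) with hx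
  set Tn : ℕ → ℝ := fun r ↦ ∑ m ∈ Finset.range n, (-(θ * x r)) ^ m / m.factorial with hTn
  set E : ℕ → ℝ := fun r ↦ Real.exp (-(θ * x r)) - Tn r with hE
  set base : ℕ → ℂ := fun r ↦ c r * (r : ℂ) ^ (-(σ : ℂ)) * (r : ℂ) ^ (-((γ : ℂ) * I)) with hbase
  set D : ℕ → ℂ := fun m ↦ ∑ r ∈ Finset.Ioc P (2 * P),
      (c r * (((x r) ^ m : ℝ) : ℂ) * (r : ℂ) ^ (-(σ : ℂ))) * (r : ℂ) ^ (-((γ : ℂ) * I)) with hD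
  set S : ℝ := ∑ r ∈ Finset.Ioc P (2 * P), ‖c r‖ * (r : ℝ) ^ (-σ) with hS
  set ρ : ℝ := (θ * Real.log 2) ^ n * (((n : ℝ) + 1) / (n.factorial * n)) with hρ
  -- bounds for `x r` and the remainder
  have hxb : ∀ r ∈ Finset.Ioc P (2 * P), 0 ≤ x r ∧ x r ≤ Real.log 2 := fun r hr ↦
    log_ratio_bounds hP hr
  have hEr : ∀ r ∈ Finset.Ioc P (2 * P), |E r| ≤ ρ := by
    intro r hr
    obtain ⟨hx0, hx1⟩ := hxb r hr
    have hθx : |(-(θ * x r))| ≤ 1 := by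
      rw [abs_neg, abs_of_nonneg (by positivity)]
      nlinarith
    have h := Real.exp_bound hθx (n := n) (by omega)
    rw [hE]; dsimp only; rw [hTn]
    refine h.trans ?_
    rw [hρ, abs_neg, abs_of_nonneg (by positivity)]
    have h1 : (θ * x r) ^ n ≤ (θ * Real.log 2) ^ n :=
      pow_le_pow_left₀ (by positivity) (by nlinarith) n
    have h2 : ((n.succ : ℕ) : ℝ) / (n.factorial * n) = ((n : ℝ) + 1) / (n.factorial * n) := by
      push_cast; ring
    rw [h2]
    exact mul_le_mul_of_nonneg_right h1 (by positivity)
  -- the pointwise identity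
  have hpt : ∀ r ∈ Finset.Ioc P (2 * P), c r * (r : ℂ) ^ (-((σ : ℂ) + θ + γ * I)) =
      (((P : ℝ) ^ (-θ) : ℝ) : ℂ) * (base r * ((Tn r : ℝ) : ℂ) + base r * ((E r : ℝ) : ℂ)) := by
    intro r hr
    have hr0 : 0 < r := by rw [Finset.mem_Ioc] at hr; omega
    rw [natCast_cpow_neg_split hP hr0 σ θ γ]
    have : Real.exp (-(θ * Real.log ((r : ℝ) / P))) = Tn r + E r := by rw [hE]; dsimp only; rw [hx]; ring
    rw [this, hbase]
    push_cast
    ring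
  have hsum : ∑ r ∈ Finset.Ioc P (2 * P), c r * (r : ℂ) ^ (-((σ : ℂ) + θ + γ * I)) =
      (((P : ℝ) ^ (-θ) : ℝ) : ℂ) *
        ((∑ m ∈ Finset.range n, (((-θ) ^ m / m.factorial : ℝ) : ℂ) * D m) +
          ∑ r ∈ Finset.Ioc P (2 * P), base r * ((E r : ℝ) : ℂ)) := by
    rw [Finset.sum_congr rfl hpt, ← Finset.mul_sum, Finset.sum_add_distrib]
    congr 2
    -- exchange the sums
    have h1 : ∀ r ∈ Finset.Ioc P (2 * P), base r * ((Tn r : ℝ) : ℂ) =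
        ∑ m ∈ Finset.range n, (((-θ) ^ m / m.factorial : ℝ) : ℂ) *
          ((c r * (((x r) ^ m : ℝ) : ℂ) * (r : ℂ) ^ (-(σ : ℂ))) * (r : ℂ) ^ (-((γ : ℂ) * I))) := by
      intro r _
      rw [hTn, hbase]; dsimp only
      push_cast
      rw [Finset.mul_sum]
      refine Finset.sum_congr rfl fun m _ ↦ ?_
      rw [neg_pow, neg_pow ((θ : ℂ))]
      ring
    rw [Finset.sum_congr rfl h1, Finset.sum_comm]
    refine Finset.sum_congr rfl fun m _ ↦ ?_
    rw [hD]; dsimp only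
    rw [Finset.mul_sum]
  -- norms
  have hPθ : (P : ℝ) ^ (-θ) ≤ 1 := Real.rpow_le_one_of_one_le_of_nonpos (by exact_mod_cast hP) (by linarith)
  have hPθ0 : 0 ≤ (P : ℝ) ^ (-θ) := by positivity
  have hA : ‖∑ m ∈ Finset.range n, (((-θ) ^ m / m.factorial : ℝ) : ℂ) * D m‖ ≤
      ∑ m ∈ Finset.range n, θ ^ m / m.factorial * ‖D m‖ := by
    refine (norm_sum_le _ _).trans (Finset.sum_le_sum fun m _ ↦ ?_)
    rw [norm_mul, Complex.norm_real, Real.norm_eq_abs, abs_div, abs_pow, abs_neg, abs_of_nonneg hθ0,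
      Nat.abs_cast]
  have hB : ‖∑ r ∈ Finset.Ioc P (2 * P), base r * ((E r : ℝ) : ℂ)‖ ≤ S * ρ := by
    rw [hS, Finset.sum_mul]
    refine (norm_sum_le _ _).trans (Finset.sum_le_sum fun r hr ↦ ?_)
    have hr0 : 0 < r := by rw [Finset.mem_Ioc] at hr; omega
    rw [norm_mul, Complex.norm_real, Real.norm_eq_abs, hbase]
    dsimp only
    rw [norm_mul, norm_mul, norm_natCast_cpow_neg_mul_I hr0, norm_natCast_cpow_neg_ofReal hr0, mul_one]
    exact mul_le_mul_of_nonneg_left (hEr r hr) (by positivity)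
  have hS0 : 0 ≤ S := by rw [hS]; exact Finset.sum_nonneg fun r _ ↦ by positivity
  have hρ0 : 0 ≤ ρ := by rw [hρ]; positivity
  have hsum0 : 0 ≤ ∑ m ∈ Finset.range n, θ ^ m / m.factorial * ‖D m‖ :=
    Finset.sum_nonneg fun m _ ↦ by positivity
  rw [hsum, norm_mul, Complex.norm_real, Real.norm_eq_abs, abs_of_nonneg hPθ0]
  calc (P : ℝ) ^ (-θ) * ‖(∑ m ∈ Finset.range n, (((-θ) ^ m / m.factorial : ℝ) : ℂ) * D m) +
          ∑ r ∈ Finset.Ioc P (2 * P), base r * ((E r : ℝ) : ℂ)‖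
      ≤ 1 * (∑ m ∈ Finset.range n, θ ^ m / m.factorial * ‖D m‖ + S * ρ) := by
        refine mul_le_mul hPθ ((norm_add_le _ _).trans (add_le_add hA hB)) (norm_nonneg _) zero_le_one
    _ = _ := by rw [one_mul]

/-- **Pigeonhole over the Taylor terms**: in the situation of `taylor_split`, if moreover
`|∑_{P<r≤2P} c(r) r^{-ρ}| ≥ V > 0` and `8 S ≤ 2^n V`, then `|D_m(γ)| ≥ V/4` for some `m < n`
(because `∑_{m<n} θ^m/m! ≤ e^{1/2} < 3` and `S (θ log 2)^n (n+1)/(n! n) ≤ 2 S 2^{-n} ≤ V/4`).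
[cite: GuthMaynard2026, Section 13, proof of Theorem 1.2] -/
theorem taylor_pigeonhole {P : ℕ} (hP : 1 ≤ P) (c : ℕ → ℂ) (σ : ℝ) {θ : ℝ} (hθ0 : 0 ≤ θ)
    (hθ : θ ≤ 1 / 2) (γ : ℝ) {n : ℕ} (hn : 1 ≤ n) {V : ℝ} (hV : 0 < V)
    (hSV : 8 * (∑ r ∈ Finset.Ioc P (2 * P), ‖c r‖ * (r : ℝ) ^ (-σ)) ≤ 2 ^ n * V)
    (hlarge : V ≤ ‖∑ r ∈ Finset.Ioc P (2 * P), c r * (r : ℂ) ^ (-((σ : ℂ) + θ + γ * I))‖) :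
    ∃ m ∈ Finset.range n, V / 4 ≤
      ‖∑ r ∈ Finset.Ioc P (2 * P), (c r * (((Real.log ((r : ℝ) / P)) ^ m : ℝ) : ℂ) *
        (r : ℂ) ^ (-(σ : ℂ))) * (r : ℂ) ^ (-((γ : ℂ) * I))‖ := by
  by_contra hcon
  push Not at hcon
  have hsplit := taylor_split hP c σ hθ0 hθ γ hn
  set S : ℝ := ∑ r ∈ Finset.Ioc P (2 * P), ‖c r‖ * (r : ℝ) ^ (-σ) with hS
  have hS0 : 0 ≤ S := Finset.sum_nonneg fun r _ ↦ by positivity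
  have hlog2 : (0 : ℝ) < Real.log 2 := Real.log_pos (by norm_num)
  have hlog2' : Real.log 2 < 1 := by
    have := Real.log_two_lt_d9; linarith
  have hn0 : (0 : ℝ) < n := by exact_mod_cast hn
  -- the remainder is at most `V/4`
  have hrem : S * ((θ * Real.log 2) ^ n * (((n : ℝ) + 1) / (n.factorial * n))) ≤ V / 4 := by
    have h1 : (θ * Real.log 2) ^ n ≤ (1 / 2) ^ n :=
      pow_le_pow_left₀ (by positivity) (by nlinarith) n
    have h2 : ((n : ℝ) + 1) / (n.factorial * n) ≤ 2 := by
      rw [div_le_iff₀ (by positivity)]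
      have hf : (1 : ℝ) ≤ n.factorial := by exact_mod_cast Nat.one_le_iff_ne_zero.2 (Nat.factorial_ne_zero n)
      have hn1 : (1 : ℝ) ≤ n := by exact_mod_cast hn
      nlinarith [mul_le_mul_of_nonneg_right hf hn0.le]
    have h3 : (θ * Real.log 2) ^ n * (((n : ℝ) + 1) / (n.factorial * n)) ≤ (1 / 2) ^ n * 2 :=
      mul_le_mul h1 h2 (by positivity) (by positivity)
    have h4 : S * ((1 / 2 : ℝ) ^ n * 2) ≤ V / 4 := by
      have h2n : (0 : ℝ) < 2 ^ n := by positivity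
      have e : (1 / 2 : ℝ) ^ n = (2 ^ n)⁻¹ := by rw [one_div, inv_pow]
      rw [e, show S * ((2 ^ n)⁻¹ * 2) = 2 * S / 2 ^ n by ring, div_le_iff₀ h2n]
      linarith
    exact (mul_le_mul_of_nonneg_left h3 hS0).trans h4
  -- the main terms are at most `(V/4) e^{θ} < 3V/4`
  have hmain : ∑ m ∈ Finset.range n, θ ^ m / m.factorial *
      ‖∑ r ∈ Finset.Ioc P (2 * P), (c r * (((Real.log ((r : ℝ) / P)) ^ m : ℝ) : ℂ) *
        (r : ℂ) ^ (-(σ : ℂ))) * (r : ℂ) ^ (-((γ : ℂ) * I))‖ < 3 * (V / 4) := by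
    have h1 : ∑ m ∈ Finset.range n, θ ^ m / m.factorial *
        ‖∑ r ∈ Finset.Ioc P (2 * P), (c r * (((Real.log ((r : ℝ) / P)) ^ m : ℝ) : ℂ) *
          (r : ℂ) ^ (-(σ : ℂ))) * (r : ℂ) ^ (-((γ : ℂ) * I))‖ ≤
        ∑ m ∈ Finset.range n, θ ^ m / m.factorial * (V / 4) :=
      Finset.sum_le_sum fun m hm ↦ mul_le_mul_of_nonneg_left (hcon m hm).le (by positivity)
    have h2 : ∑ m ∈ Finset.range n, θ ^ m / m.factorial * (V / 4) ≤ Real.exp θ * (V / 4) := by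
      rw [← Finset.sum_mul]
      exact mul_le_mul_of_nonneg_right (Real.sum_le_exp_of_nonneg hθ0 n) (by positivity)
    have h3 : Real.exp θ < 3 := by
      calc Real.exp θ ≤ Real.exp 1 := Real.exp_le_exp.2 (by linarith)
        _ < 3 := by have := Real.exp_one_lt_d9; linarith
    have h4 : Real.exp θ * (V / 4) < 3 * (V / 4) := mul_lt_mul_of_pos_right h3 (by positivity)
    linarith
  linarith

/-! ## §2. Counting `1`-separated real points: the large values estimate and the mean value theorem -/

/-- **The large values estimate applied to a block with bounded coefficients.** Suppose that for
the present `T` the large values bound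
`#W ≤ C₁ (N²V⁻² + N^{18/5}V⁻⁴ + T N^{12/5}V⁻⁴)` holds for every `1 ≤ N ≤ T`, every `1`-bounded
`b`, every `V > 0` and every `1`-separated `W ⊂ [0, T]` with `|∑_{N≤n≤2N} b(n) n^{it}| ≥ V` on `W`
(Guth–Maynard, Theorem 1.1, at this `T`). If `1 ≤ P ≤ T`, `|a(r)| ≤ A` on `(P, 2P]` (`A > 0`) and
`|∑_{P<r≤2P} a(r) r^{-it}| ≥ V > 0` on a `1`-separated `W ⊂ [0, T]`, then (conjugating and dividing
by `A`) `#W ≤ C₁ (P²(A/V)² + P^{18/5}(A/V)⁴ + T P^{12/5}(A/V)⁴)`.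
[cite: GuthMaynard2026, Theorem 1.1] -/
theorem realPoints_count_LV {T C₁ : ℝ}
    (hLVT : ∀ (N : ℕ) (b : ℕ → ℂ) (V : ℝ) (W : Finset ℝ), 1 ≤ N → (N : ℝ) ≤ T →
      (∀ n, ‖b n‖ ≤ 1) → 0 < V → (∀ t ∈ W, 0 ≤ t ∧ t ≤ T) →
      (∀ t ∈ W, ∀ t' ∈ W, t ≠ t' → 1 ≤ |t - t'|) →
      (∀ t ∈ W, V ≤ ‖∑ n ∈ Finset.Icc N (2 * N), b n * (n : ℂ) ^ ((t : ℂ) * I)‖) →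
      (W.card : ℝ) ≤ C₁ * ((N : ℝ) ^ 2 * V⁻¹ ^ 2 + (N : ℝ) ^ (18 / 5 : ℝ) * V⁻¹ ^ 4 +
        T * (N : ℝ) ^ (12 / 5 : ℝ) * V⁻¹ ^ 4))
    {P : ℕ} (hP : 1 ≤ P) (hPT : (P : ℝ) ≤ T) {a : ℕ → ℂ} {A : ℝ} (hA : 0 < A)
    (ha : ∀ r ∈ Finset.Ioc P (2 * P), ‖a r‖ ≤ A) {V : ℝ} (hV : 0 < V) (W : Finset ℝ)
    (hW : ∀ t ∈ W, 0 ≤ t ∧ t ≤ T) (hsep : ∀ t ∈ W, ∀ t' ∈ W, t ≠ t' → 1 ≤ |t - t'|)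
    (hlarge : ∀ t ∈ W, V ≤ ‖∑ r ∈ Finset.Ioc P (2 * P), a r * (r : ℂ) ^ (-((t : ℂ) * I))‖) :
    (W.card : ℝ) ≤ C₁ * ((P : ℝ) ^ 2 * (A / V) ^ 2 + (P : ℝ) ^ (18 / 5 : ℝ) * (A / V) ^ 4 +
        T * (P : ℝ) ^ (12 / 5 : ℝ) * (A / V) ^ 4) := by
  classical
  set b : ℕ → ℂ := fun n ↦ if n ∈ Finset.Ioc P (2 * P) then (starRingEnd ℂ) (a n) / A else 0
    with hb
  have hb1 : ∀ n, ‖b n‖ ≤ 1 := by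
    intro n
    rw [hb]; dsimp only
    split_ifs with h
    · rw [norm_div, Complex.norm_conj, Complex.norm_real, Real.norm_of_nonneg hA.le,
        div_le_one hA]
      exact ha n h
    · simp
  have hsub : Finset.Ioc P (2 * P) ⊆ Finset.Icc P (2 * P) := fun n hn ↦ by
    rw [Finset.mem_Ioc] at hn; rw [Finset.mem_Icc]; omega
  have hsumeq : ∀ t : ℝ, ∑ n ∈ Finset.Icc P (2 * P), b n * (n : ℂ) ^ ((t : ℂ) * I) =
      (starRingEnd ℂ) (∑ r ∈ Finset.Ioc P (2 * P), a r * (r : ℂ) ^ (-((t : ℂ) * I))) / A := by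
    intro t
    rw [← Finset.sum_subset hsub (fun n _ hn ↦ by rw [hb]; dsimp only; rw [if_neg hn, zero_mul]),
      map_sum, Finset.sum_div]
    refine Finset.sum_congr rfl fun n hn ↦ ?_
    rw [hb]; dsimp only
    rw [if_pos hn, map_mul, HuxleyLV.conj_natCast_cpow]
    have : -(starRingEnd ℂ) ((t : ℂ) * I) = (t : ℂ) * I := by
      rw [map_mul, Complex.conj_ofReal, Complex.conj_I]; ring
    rw [this]
    ring
  have hlarge' : ∀ t ∈ W, V / A ≤ ‖∑ n ∈ Finset.Icc P (2 * P), b n * (n : ℂ) ^ ((t : ℂ) * I)‖ := by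
    intro t ht
    rw [hsumeq t, norm_div, Complex.norm_conj, Complex.norm_real, Real.norm_of_nonneg hA.le,
      div_le_div_iff_of_pos_right hA]
    exact hlarge t ht
  have h := hLVT P b (V / A) W hP hPT hb1 (div_pos hV hA) hW hsep hlarge'
  have e : (V / A)⁻¹ = A / V := by rw [inv_div]
  rwa [e] at h

/-- **The mean value theorem applied to a block with bounded coefficients** (the "usual Mean
Value Theorem" of Guth–Maynard §13, here the discrete mean value theorem of the tree,
`Gallagher.discreteMeanValue`): if `P ≥ 1`, `T ≥ 1`, `|a(r)| ≤ A` on `(P, 2P]` and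
`|∑_{P<r≤2P} a(r) r^{-it}| ≥ V > 0` on a `1`-separated `W ⊂ [0, T]`, then
`#W ≤ V⁻² A² P (5T + 3 + 36P)(1 + log(2P))`. [cite: GuthMaynard2026, Section 13, proof of Theorem 1.2] -/
theorem realPoints_count_MVT {T : ℝ} (hT : 1 ≤ T) {P : ℕ} (hP : 1 ≤ P) {a : ℕ → ℂ} {A : ℝ}
    (ha : ∀ r ∈ Finset.Ioc P (2 * P), ‖a r‖ ≤ A) {V : ℝ} (hV : 0 < V)
    (W : Finset ℝ) (hW : ∀ t ∈ W, 0 ≤ t ∧ t ≤ T)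
    (hsep : ∀ t ∈ W, ∀ t' ∈ W, t ≠ t' → 1 ≤ |t - t'|)
    (hlarge : ∀ t ∈ W, V ≤ ‖∑ r ∈ Finset.Ioc P (2 * P), a r * (r : ℂ) ^ (-((t : ℂ) * I))‖) :
    (W.card : ℝ) ≤ V⁻¹ ^ 2 * (A ^ 2 * P * ((5 * T + 3 + 36 * P) * (1 + Real.log (2 * (P : ℝ))))) := by
  classical
  have hP0 : (0 : ℝ) < P := by exact_mod_cast hP
  set a' : ℕ → ℂ := fun n ↦ if n ∈ Finset.Ioc P (2 * P) then a n else 0 with ha'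
  have hsub : Finset.Ioc P (2 * P) ⊆ Finset.Icc 1 (2 * P) := fun n hn ↦ by
    rw [Finset.mem_Ioc] at hn; rw [Finset.mem_Icc]; omega
  have hsumeq : ∀ t : ℝ, ∑ n ∈ Finset.Icc 1 (2 * P), a' n * (n : ℂ) ^ (-((t : ℂ) * I)) =
      ∑ r ∈ Finset.Ioc P (2 * P), a r * (r : ℂ) ^ (-((t : ℂ) * I)) := by
    intro t
    rw [← Finset.sum_subset hsub (fun n _ hn ↦ by rw [ha']; dsimp only; rw [if_neg hn, zero_mul])]
    refine Finset.sum_congr rfl fun n hn ↦ ?_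
    rw [ha']; dsimp only; rw [if_pos hn]
  have hcoef : ∑ n ∈ Finset.Icc 1 (2 * P), ‖a' n‖ ^ 2 ≤ A ^ 2 * P := by
    rw [← Finset.sum_subset hsub (fun n _ hn ↦ by rw [ha']; dsimp only; rw [if_neg hn, norm_zero]; ring)]
    have h1 : ∀ n ∈ Finset.Ioc P (2 * P), ‖a' n‖ ^ 2 ≤ A ^ 2 := by
      intro n hn
      rw [ha']; dsimp only; rw [if_pos hn]
      exact pow_le_pow_left₀ (norm_nonneg _) (ha n hn) 2
    calc ∑ n ∈ Finset.Ioc P (2 * P), ‖a' n‖ ^ 2 ≤ ∑ n ∈ Finset.Ioc P (2 * P), A ^ 2 :=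
          Finset.sum_le_sum h1
      _ = A ^ 2 * P := by
          rw [Finset.sum_const, Nat.card_Ioc, nsmul_eq_mul, show 2 * P - P = P by omega]; ring
  have hmem : ∀ t ∈ W, |t| ≤ T := fun t ht ↦ by
    have := hW t ht; rw [abs_of_nonneg this.1]; exact this.2
  have hMV := Gallagher.discreteMeanValue a' (2 * P) (by linarith) one_pos W hmem hsep
  simp only [inv_one] at hMV
  have hlog : Real.log ((2 * P : ℕ) : ℝ) = Real.log (2 * (P : ℝ)) := by push_cast; ring_nf
  rw [hlog] at hMV
  -- `#W V² ≤ ∑ |…|²`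
  have hlow : (W.card : ℝ) * V ^ 2 ≤
      ∑ t ∈ W, ‖∑ n ∈ Finset.Icc 1 (2 * P), a' n * (n : ℂ) ^ (-((t : ℂ) * I))‖ ^ 2 := by
    calc (W.card : ℝ) * V ^ 2 = ∑ _t ∈ W, V ^ 2 := by simp
      _ ≤ _ := Finset.sum_le_sum fun t ht ↦ by
          rw [hsumeq t]; exact pow_le_pow_left₀ hV.le (hlarge t ht) 2
  have hP1 : (1 : ℝ) ≤ P := by exact_mod_cast hP
  have hlog0 : 0 ≤ Real.log (2 * (P : ℝ)) := Real.log_nonneg (by linarith)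
  have hK0 : 0 ≤ (5 * (T + 1 / 2) + 18 * ((2 * P : ℕ) : ℝ)) * (1 + Real.log (2 * (P : ℝ))) := by
    positivity
  have hup : ∑ t ∈ W, ‖∑ n ∈ Finset.Icc 1 (2 * P), a' n * (n : ℂ) ^ (-((t : ℂ) * I))‖ ^ 2 ≤
      A ^ 2 * P * ((5 * T + 3 + 36 * P) * (1 + Real.log (2 * (P : ℝ)))) := by
    refine hMV.trans ?_
    calc (5 * (T + 1 / 2) + 18 * ((2 * P : ℕ) : ℝ)) * (1 + Real.log (2 * (P : ℝ))) *
          ∑ n ∈ Finset.Icc 1 (2 * P), ‖a' n‖ ^ 2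
        ≤ (5 * (T + 1 / 2) + 18 * ((2 * P : ℕ) : ℝ)) * (1 + Real.log (2 * (P : ℝ))) * (A ^ 2 * P) :=
          mul_le_mul_of_nonneg_left hcoef hK0
      _ ≤ A ^ 2 * P * ((5 * T + 3 + 36 * P) * (1 + Real.log (2 * (P : ℝ)))) := by
          push_cast
          have : (5 * (T + 1 / 2) + 18 * (2 * (P : ℝ))) ≤ 5 * T + 3 + 36 * P := by linarith
          nlinarith [mul_nonneg (mul_nonneg (sq_nonneg A) hP0.le) hlog0,
            mul_nonneg (sq_nonneg A) hP0.le]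
  have hV2 : 0 < V ^ 2 := by positivity
  calc (W.card : ℝ) = (W.card * V ^ 2) * V⁻¹ ^ 2 := by field_simp
    _ ≤ (A ^ 2 * P * ((5 * T + 3 + 36 * P) * (1 + Real.log (2 * (P : ℝ))))) * V⁻¹ ^ 2 :=
        mul_le_mul_of_nonneg_right (hlow.trans hup) (by positivity)
    _ = _ := by ring

/-! ## §3. The class (i) zeros: blocks, powers, sub-blocks, Taylor terms -/

/-- **Large values of a polynomial supported on `(L, 2^k L]`, counted on real points.** Let
`1/2 ≤ σ`, `|b(r)| ≤ E r^η` (`r ≥ 1`), `L, k ≥ 1` with `Y₁ ≤ L` and `2^k L ≤ Y₂`, and let `Z` be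
a finite set of points `ρ = β + iγ` with `σ ≤ β ≤ σ + 1/2`, `0 ≤ γ ≤ T`, ordinates pairwise `≥ 1`
apart, each with `|∑_{L<r≤2^kL} b(r) r^{-ρ}| ≥ W₁ > 0`. Suppose every `1`-separated set of real
points `t ∈ [0, T]` at which a block polynomial `∑_{P<r≤2P} a(r) r^{-it}` (`Y₁ ≤ P`, `2P ≤ Y₂`,
`|a(r)| ≤ E Y₂^η P^{-σ}`) is `≥ V ≥ V₀` in modulus has at most `R₀` elements, where
`V₀ ≤ W₁/(4k)`, and let `n ≥ 1` with `8 E Y₂^{1+η} ≤ 2^n W₁/k`. Then `|Z| ≤ k n R₀`: pigeonhole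
over the `k` dyadic blocks (`HuxleyIvic.exists_block_ge`), removal of the real part by
`taylor_pigeonhole` (`n` Taylor terms), and the hypothesis on the ordinates.
[cite: GuthMaynard2026, Section 13, proof of Theorem 1.2] -/
theorem dyadicPoly_card_le_gm {σ T : ℝ} (hσ : 1 / 2 ≤ σ)
    {b : ℕ → ℂ} {E η : ℝ} (hE : 0 ≤ E) (hη : 0 ≤ η)
    (hb : ∀ r : ℕ, 1 ≤ r → ‖b r‖ ≤ E * (r : ℝ) ^ η)
    {L k : ℕ} (hL : 1 ≤ L) (hk : 1 ≤ k) {Y₁ Y₂ : ℝ} (hY₁L : Y₁ ≤ (L : ℝ))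
    (hLY₂ : (2 : ℝ) ^ k * L ≤ Y₂)
    {W₁ : ℝ} (hW₁ : 0 < W₁) {V₀ : ℝ} (hV₀ : V₀ ≤ W₁ / k / 4)
    {n : ℕ} (hn : 1 ≤ n) (h2n : 8 * (E * Y₂ ^ η * Y₂) ≤ 2 ^ n * (W₁ / k))
    {R₀ : ℝ}
    (hblk : ∀ (P : ℕ) (a : ℕ → ℂ) (V : ℝ) (W : Finset ℝ), 1 ≤ P → Y₁ ≤ (P : ℝ) →
      2 * (P : ℝ) ≤ Y₂ →
      (∀ r ∈ Finset.Ioc P (2 * P), ‖a r‖ ≤ E * Y₂ ^ η * (P : ℝ) ^ (-σ)) → V₀ ≤ V →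
      (∀ t ∈ W, 0 ≤ t ∧ t ≤ T) → (∀ t ∈ W, ∀ t' ∈ W, t ≠ t' → 1 ≤ |t - t'|) →
      (∀ t ∈ W, V ≤ ‖∑ r ∈ Finset.Ioc P (2 * P), a r * (r : ℂ) ^ (-((t : ℂ) * I))‖) →
      (W.card : ℝ) ≤ R₀)
    (Z : Finset ℂ) (hre : ∀ ρ ∈ Z, σ ≤ ρ.re ∧ ρ.re ≤ σ + 1 / 2)
    (him : ∀ ρ ∈ Z, 0 ≤ ρ.im ∧ ρ.im ≤ T)
    (hsep : ∀ ρ ∈ Z, ∀ ρ' ∈ Z, ρ ≠ ρ' → 1 ≤ |ρ.im - ρ'.im|)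
    (hlarge : ∀ ρ ∈ Z, W₁ ≤ ‖∑ r ∈ Finset.Ioc L (L * 2 ^ k), b r * (r : ℂ) ^ (-ρ)‖) :
    (Z.card : ℝ) ≤ k * (n * R₀) := by
  classical
  have hk0 : (0 : ℝ) < k := by exact_mod_cast hk
  have hL0 : (0 : ℝ) < L := by exact_mod_cast hL
  have hL1 : (1 : ℝ) ≤ L := by exact_mod_cast hL
  have hY₂1 : 1 ≤ Y₂ := by
    have : (1 : ℝ) ≤ 2 ^ k * L := one_le_mul_of_one_le_of_one_le (one_le_pow₀ (by norm_num)) hL1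
    linarith
  have hY₂0 : 0 < Y₂ := by linarith
  have hlog2' : Real.log 2 < 1 := by have := Real.log_two_lt_d9; linarith
  -- the blocks
  set B : ℕ → ℂ → ℂ := fun j ρ ↦ ∑ r ∈ Finset.Ioc (L * 2 ^ j) (L * 2 ^ (j + 1)), b r * (r : ℂ) ^ (-ρ)
    with hBdef
  have hsplit : ∀ ρ : ℂ, ∑ r ∈ Finset.Ioc L (L * 2 ^ k), b r * (r : ℂ) ^ (-ρ) =
      ∑ j ∈ Finset.range k, B j ρ := fun ρ ↦ ZeroDensity.sum_Ioc_mul_two_pow _ L k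
  set V : ℝ := W₁ / k with hV
  have hV0 : 0 < V := div_pos hW₁ hk0
  set Zj : ℕ → Finset ℂ := fun j ↦ Z.filter (fun ρ ↦ V ≤ ‖B j ρ‖) with hZj
  have hcover : Z ⊆ (Finset.range k).biUnion Zj := by
    intro ρ hρ
    have h := hlarge ρ hρ
    rw [hsplit ρ] at h
    obtain ⟨j, hj, hlargej⟩ := exists_block_ge hk h
    rw [Finset.mem_biUnion]
    exact ⟨j, hj, by rw [hZj, Finset.mem_filter]; exact ⟨hρ, hlargej⟩⟩
  -- one block
  have hblock : ∀ j ∈ Finset.range k, ((Zj j).card : ℝ) ≤ n * R₀ := by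
    intro j hj
    rw [Finset.mem_range] at hj
    set P : ℕ := L * 2 ^ j with hP
    have hP1 : 1 ≤ P := by rw [hP]; exact Nat.one_le_iff_ne_zero.2 (by positivity)
    have hP0 : (0 : ℝ) < P := by exact_mod_cast hP1
    have hblk2 : L * 2 ^ (j + 1) = 2 * P := by rw [hP]; ring
    have hLP : (L : ℝ) ≤ P := by
      rw [hP]; push_cast
      exact le_mul_of_one_le_right hL0.le (one_le_pow₀ (by norm_num))
    have hY₁P : Y₁ ≤ (P : ℝ) := hY₁L.trans hLP
    have h2P : 2 * (P : ℝ) ≤ 2 ^ k * L := by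
      rw [hP]; push_cast
      have : (2 : ℝ) ^ (j + 1) ≤ 2 ^ k := pow_le_pow_right₀ (by norm_num) (by omega)
      calc 2 * ((L : ℝ) * 2 ^ j) = 2 ^ (j + 1) * L := by ring
        _ ≤ 2 ^ k * L := mul_le_mul_of_nonneg_right this hL0.le
    have h2PY₂ : 2 * (P : ℝ) ≤ Y₂ := h2P.trans hLY₂
    -- coefficient facts on `(P, 2P]`
    have hcoefP : ∀ r ∈ Finset.Ioc P (2 * P), ‖b r‖ ≤ E * Y₂ ^ η ∧
        (r : ℝ) ^ (-σ) ≤ (P : ℝ) ^ (-σ) ∧ (r : ℝ) ^ (-σ) ≤ 1 := by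
      intro r hr
      have hr' := hr
      rw [Finset.mem_Ioc] at hr
      have hr1 : 1 ≤ r := by omega
      have hr0 : (0 : ℝ) < r := by exact_mod_cast (by omega : 0 < r)
      have hrY : (r : ℝ) ≤ Y₂ := by
        have : (r : ℝ) ≤ 2 * P := by exact_mod_cast hr.2
        linarith
      refine ⟨(hb r hr1).trans (mul_le_mul_of_nonneg_left
        (Real.rpow_le_rpow hr0.le hrY hη) hE), ?_, ?_⟩
      · exact Real.rpow_le_rpow_of_nonpos hP0 (by exact_mod_cast hr.1.le) (by linarith)
      · exact Real.rpow_le_one_of_one_le_of_nonpos (by exact_mod_cast hr1) (by linarith)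
    -- the Taylor polynomials
    set D : ℕ → ℝ → ℂ := fun m t ↦ ∑ r ∈ Finset.Ioc P (2 * P),
        (b r * (((Real.log ((r : ℝ) / P)) ^ m : ℝ) : ℂ) * (r : ℂ) ^ (-(σ : ℂ))) *
          (r : ℂ) ^ (-((t : ℂ) * I)) with hD
    set Zjm : ℕ → Finset ℂ := fun m ↦ (Zj j).filter (fun ρ ↦ V / 4 ≤ ‖D m ρ.im‖) with hZjm
    -- `8 S ≤ 2^n V`
    have hS : 8 * (∑ r ∈ Finset.Ioc P (2 * P), ‖b r‖ * (r : ℝ) ^ (-σ)) ≤ 2 ^ n * V := by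
      have h1 : ∑ r ∈ Finset.Ioc P (2 * P), ‖b r‖ * (r : ℝ) ^ (-σ) ≤
          ∑ r ∈ Finset.Ioc P (2 * P), E * Y₂ ^ η := by
        refine Finset.sum_le_sum fun r hr ↦ ?_
        obtain ⟨h1, -, h3⟩ := hcoefP r hr
        calc ‖b r‖ * (r : ℝ) ^ (-σ) ≤ (E * Y₂ ^ η) * 1 :=
              mul_le_mul h1 h3 (by positivity) (by positivity)
          _ = E * Y₂ ^ η := mul_one _
      rw [Finset.sum_const, Nat.card_Ioc, nsmul_eq_mul, show 2 * P - P = P by omega] at h1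
      have hPY : (P : ℝ) ≤ Y₂ := by linarith
      have h2 : (P : ℝ) * (E * Y₂ ^ η) ≤ Y₂ * (E * Y₂ ^ η) :=
        mul_le_mul_of_nonneg_right hPY (by positivity)
      calc 8 * ∑ r ∈ Finset.Ioc P (2 * P), ‖b r‖ * (r : ℝ) ^ (-σ) ≤ 8 * (Y₂ * (E * Y₂ ^ η)) := by
            linarith
        _ = 8 * (E * Y₂ ^ η * Y₂) := by ring
        _ ≤ 2 ^ n * V := h2n
    have hcov2 : Zj j ⊆ (Finset.range n).biUnion Zjm := by
      intro ρ hρ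
      have hρ' := hρ
      rw [hZj, Finset.mem_filter] at hρ
      obtain ⟨hρZ, hρV⟩ := hρ
      obtain ⟨hre1, hre2⟩ := hre ρ hρZ
      have hlargeρ : V ≤ ‖∑ r ∈ Finset.Ioc P (2 * P),
          b r * (r : ℂ) ^ (-((σ : ℂ) + (ρ.re - σ : ℝ) + (ρ.im : ℝ) * I))‖ := by
        have e : (σ : ℂ) + (ρ.re - σ : ℝ) + (ρ.im : ℝ) * I = ρ := by
          apply Complex.ext <;> simp
        rw [e]
        have := hρV
        rw [hBdef] at this; dsimp only at this
        rwa [hblk2] at this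
      obtain ⟨m, hm, hlargem⟩ := taylor_pigeonhole hP1 b σ (θ := ρ.re - σ) (by linarith)
        (by linarith) ρ.im hn hV0 hS hlargeρ
      rw [Finset.mem_biUnion]
      refine ⟨m, hm, ?_⟩
      rw [hZjm, Finset.mem_filter]
      exact ⟨hρ', by rw [hD]; exact hlargem⟩
    -- one Taylor term
    have hterm : ∀ m ∈ Finset.range n, ((Zjm m).card : ℝ) ≤ R₀ := by
      intro m _
      set Wm : Finset ℝ := (Zjm m).image Complex.im with hWm
      have hZjmZ : ∀ ρ ∈ Zjm m, ρ ∈ Z := fun ρ hρ ↦ by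
        rw [hZjm, Finset.mem_filter, hZj, Finset.mem_filter] at hρ; exact hρ.1.1
      have hinj : Set.InjOn Complex.im (Zjm m : Set ℂ) := by
        intro ρ hρ ρ' hρ' heq
        by_contra hne
        have h1 := hsep ρ (hZjmZ ρ hρ) ρ' (hZjmZ ρ' hρ') hne
        rw [heq, sub_self, abs_zero] at h1
        linarith
      have hcardeq : (Zjm m).card = Wm.card := (Finset.card_image_of_injOn hinj).symm
      -- the hypotheses of `hblk`
      have ha : ∀ r ∈ Finset.Ioc P (2 * P),
          ‖b r * (((Real.log ((r : ℝ) / P)) ^ m : ℝ) : ℂ) * (r : ℂ) ^ (-(σ : ℂ))‖ ≤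
            E * Y₂ ^ η * (P : ℝ) ^ (-σ) := by
        intro r hr
        obtain ⟨h1, h2, -⟩ := hcoefP r hr
        obtain ⟨hx0, hx1⟩ := log_ratio_bounds hP1 hr
        have hr0 : 0 < r := by rw [Finset.mem_Ioc] at hr; omega
        have hxm : |Real.log ((r : ℝ) / P) ^ m| ≤ 1 := by
          rw [abs_pow, abs_of_nonneg hx0]
          exact pow_le_one₀ hx0 (by linarith)
        rw [norm_mul, norm_mul, Complex.norm_real, Real.norm_eq_abs, norm_natCast_cpow_neg_ofReal hr0]
        calc ‖b r‖ * |Real.log ((r : ℝ) / P) ^ m| * (r : ℝ) ^ (-σ)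
            ≤ (E * Y₂ ^ η) * 1 * (P : ℝ) ^ (-σ) := by
              refine mul_le_mul (mul_le_mul h1 hxm (abs_nonneg _) (by positivity)) h2
                (by positivity) (by positivity)
          _ = E * Y₂ ^ η * (P : ℝ) ^ (-σ) := by ring
      have hWT : ∀ t ∈ Wm, 0 ≤ t ∧ t ≤ T := by
        intro t ht
        rw [hWm, Finset.mem_image] at ht
        obtain ⟨ρ, hρ, rfl⟩ := ht
        exact him ρ (hZjmZ ρ hρ)
      have hWsep : ∀ t ∈ Wm, ∀ t' ∈ Wm, t ≠ t' → 1 ≤ |t - t'| := by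
        intro t ht t' ht' hne
        rw [hWm, Finset.mem_image] at ht ht'
        obtain ⟨ρ, hρ, rfl⟩ := ht
        obtain ⟨ρ', hρ', rfl⟩ := ht'
        exact hsep ρ (hZjmZ ρ hρ) ρ' (hZjmZ ρ' hρ') (fun h ↦ hne (by rw [h]))
      have hWlarge : ∀ t ∈ Wm, V / 4 ≤ ‖∑ r ∈ Finset.Ioc P (2 * P),
          (b r * (((Real.log ((r : ℝ) / P)) ^ m : ℝ) : ℂ) * (r : ℂ) ^ (-(σ : ℂ))) *
            (r : ℂ) ^ (-((t : ℂ) * I))‖ := by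
        intro t ht
        rw [hWm, Finset.mem_image] at ht
        obtain ⟨ρ, hρ, rfl⟩ := ht
        rw [hZjm, Finset.mem_filter] at hρ
        have := hρ.2
        rw [hD] at this
        exact this
      have hV4 : V₀ ≤ V / 4 := by rw [hV]; exact hV₀
      have h := hblk P _ (V / 4) Wm hP1 hY₁P h2PY₂ ha hV4 hWT hWsep hWlarge
      rw [hcardeq]; exact h
    calc ((Zj j).card : ℝ) ≤ (((Finset.range n).biUnion Zjm).card : ℝ) := by
          exact_mod_cast Finset.card_le_card hcov2
      _ ≤ ∑ m ∈ Finset.range n, ((Zjm m).card : ℝ) := by exact_mod_cast Finset.card_biUnion_le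
      _ ≤ ∑ m ∈ Finset.range n, R₀ := Finset.sum_le_sum hterm
      _ = n * R₀ := by rw [Finset.sum_const, Finset.card_range, nsmul_eq_mul]
  -- sum over the blocks
  calc (Z.card : ℝ) ≤ (((Finset.range k).biUnion Zj).card : ℝ) := by
        exact_mod_cast Finset.card_le_card hcover
    _ ≤ ∑ j ∈ Finset.range k, ((Zj j).card : ℝ) := by exact_mod_cast Finset.card_biUnion_le
    _ ≤ ∑ j ∈ Finset.range k, n * R₀ := Finset.sum_le_sum hblock
    _ = k * (n * R₀) := by rw [Finset.sum_const, Finset.card_range, nsmul_eq_mul]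

/-- **The class (i) zeros, each block raised to a power and counted on real points** (the
zero-detecting step of Guth–Maynard §13 — Type I zeros, the polynomial `D` raised to the power
`k`, large values of `D̃^k` on a `1`-separated set of ordinates — in the tree's normalisation of
`HuxleyIvic.classOne_card_le'`). Let `1/2 ≤ σ ≤ 1`, `X ≥ 1`, `1 ≤ N₀ < 2^J`,
`|c(n)| ≤ d(n) ≤ C_d n^θ` (`C_d ≥ 1`, `θ ≥ 0`), `K ≥ 1` with `2Kθ ≤ η`, and suppose that for every
`X ≤ M < N₀` there is `1 ≤ k ≤ K` with `Y₁ ≤ M^k` and `(2M)^k ≤ Y₂`. Suppose every `1`-separated set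
of real points `t ∈ [0, T]` at which a block polynomial `∑_{P<r≤2P} a(r) r^{-it}` (`Y₁ ≤ P`,
`2P ≤ Y₂`, `|a(r)| ≤ E Y₂^η P^{-σ}`, `E = C_d^{2K}`) is `≥ V ≥ (3J)^{-K}/(4K)` in modulus has at
most `R₀` elements, and let `n ≥ 1` with `8 E Y₂^{1+η} K (3J)^K ≤ 2^n`. Then among the points
`ρ = β + iγ` of a finite set `Z` with `σ ≤ β ≤ 1`, `0 ≤ γ ≤ T`, ordinates pairwise `≥ 1` apart, at
most `J · K · n · R₀` have `|∑_{X<n≤N₀} c(n) n^{-ρ}| > 1/3`.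
[cite: GuthMaynard2026, Section 13, proof of Theorem 1.2] -/
theorem classOne_card_le_gm {C_d θ η : ℝ} (hθ : 0 ≤ θ) (hη : 0 ≤ η) (hCd1 : 1 ≤ C_d)
    (hd : ∀ n : ℕ, (n.divisors.card : ℝ) ≤ C_d * (n : ℝ) ^ θ)
    {K : ℕ} (hK : 1 ≤ K) (hθK : 2 * K * θ ≤ η)
    {c : ℕ → ℂ} (hc : ∀ n, ‖c n‖ ≤ (n.divisors.card : ℝ))
    {σ T : ℝ} (hσ : 1 / 2 ≤ σ) {X N₀ J : ℕ} (hX : 1 ≤ X)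
    (hJ : N₀ < 2 ^ J) {Y₁ Y₂ : ℝ} (hY₁ : 1 ≤ Y₁)
    (hkex : ∀ M : ℕ, X ≤ M → M < N₀ →
      ∃ k : ℕ, 1 ≤ k ∧ k ≤ K ∧ Y₁ ≤ (M : ℝ) ^ k ∧ (2 * (M : ℝ)) ^ k ≤ Y₂)
    {n : ℕ} (hn : 1 ≤ n)
    (h2n : 8 * (((C_d ^ 2) ^ K) * Y₂ ^ η * Y₂) * (K * (3 * (J : ℝ)) ^ K) ≤ 2 ^ n)
    {R₀ : ℝ} (hR₀ : 0 ≤ R₀)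
    (hblk : ∀ (P : ℕ) (a : ℕ → ℂ) (V : ℝ) (W : Finset ℝ), 1 ≤ P → Y₁ ≤ (P : ℝ) →
      2 * (P : ℝ) ≤ Y₂ →
      (∀ r ∈ Finset.Ioc P (2 * P), ‖a r‖ ≤ ((C_d ^ 2) ^ K) * Y₂ ^ η * (P : ℝ) ^ (-σ)) →
      (1 / (3 * (J : ℝ))) ^ K / K / 4 ≤ V →
      (∀ t ∈ W, 0 ≤ t ∧ t ≤ T) → (∀ t ∈ W, ∀ t' ∈ W, t ≠ t' → 1 ≤ |t - t'|) →
      (∀ t ∈ W, V ≤ ‖∑ r ∈ Finset.Ioc P (2 * P), a r * (r : ℂ) ^ (-((t : ℂ) * I))‖) →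
      (W.card : ℝ) ≤ R₀)
    (Z : Finset ℂ) (hre : ∀ ρ ∈ Z, σ ≤ ρ.re ∧ ρ.re ≤ 1) (him : ∀ ρ ∈ Z, 0 ≤ ρ.im ∧ ρ.im ≤ T)
    (hsep : ∀ ρ ∈ Z, ∀ ρ' ∈ Z, ρ ≠ ρ' → 1 ≤ |ρ.im - ρ'.im|) :
    ((Z.filter (fun ρ ↦ 1 / 3 < ‖∑ n ∈ Finset.Ioc X N₀, c n * (n : ℂ) ^ (-ρ)‖)).card : ℝ) ≤
      J * (K * (n * R₀)) := by
  classical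
  -- `J ≥ 1` unless the statement is trivial
  rcases Nat.eq_zero_or_pos J with hJ0 | hJpos
  · subst hJ0
    have hN₀0 : N₀ = 0 := by simp at hJ; omega
    subst hN₀0
    have hempty : Z.filter (fun ρ ↦ 1 / 3 < ‖∑ n ∈ Finset.Ioc X 0, c n * (n : ℂ) ^ (-ρ)‖) = ∅ := by
      rw [Finset.eq_empty_iff_forall_notMem]
      intro ρ hρ
      rw [Finset.mem_filter] at hρ
      have : Finset.Ioc X 0 = ∅ := by
        rw [Finset.eq_empty_iff_forall_notMem]; intro x hx; rw [Finset.mem_Ioc] at hx; omega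
      rw [this, Finset.sum_empty, norm_zero] at hρ
      linarith [hρ.2]
    rw [hempty]; simp
  have hJ1 : 1 ≤ J := hJpos
  have hJ0 : (0 : ℝ) < J := by exact_mod_cast hJ1
  have hK0 : (0 : ℝ) < K := by exact_mod_cast hK
  have hX0 : (0 : ℝ) < X := by exact_mod_cast hX
  have hY₁0 : 0 < Y₁ := by linarith
  set E : ℝ := (C_d ^ 2) ^ K with hEdef
  have hCd0 : 0 ≤ C_d := by linarith
  have hE1 : 1 ≤ E := one_le_pow₀ (one_le_pow₀ hCd1)
  have hE0 : 0 ≤ E := by linarith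
  -- the truncated coefficients
  set c' : ℕ → ℂ := fun m ↦ if m ≤ N₀ then c m else 0 with hc'def
  have hc' : ∀ m, ‖c' m‖ ≤ (m.divisors.card : ℝ) := by
    intro m; rw [hc'def]; dsimp only
    split_ifs
    · exact hc m
    · simp
  -- the blocks
  set B : ℕ → ℂ → ℂ := fun i ρ ↦ ∑ m ∈ Finset.Ioc (X * 2 ^ i) (X * 2 ^ (i + 1)), c' m * (m : ℂ) ^ (-ρ)
    with hBdef
  have hNXJ : N₀ ≤ X * 2 ^ J := by
    calc N₀ ≤ 2 ^ J := hJ.le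
      _ = 1 * 2 ^ J := (one_mul _).symm
      _ ≤ X * 2 ^ J := Nat.mul_le_mul_right _ hX
  have hsplit : ∀ ρ : ℂ, ∑ m ∈ Finset.Ioc X N₀, c m * (m : ℂ) ^ (-ρ) =
      ∑ i ∈ Finset.range J, B i ρ := by
    intro ρ
    have h1 : ∑ m ∈ Finset.Ioc X N₀, c m * (m : ℂ) ^ (-ρ) =
        ∑ m ∈ Finset.Ioc X (X * 2 ^ J), c' m * (m : ℂ) ^ (-ρ) := by
      have hsub : Finset.Ioc X N₀ ⊆ Finset.Ioc X (X * 2 ^ J) := fun m hm ↦ by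
        simp only [Finset.mem_Ioc] at hm ⊢; exact ⟨hm.1, hm.2.trans hNXJ⟩
      rw [← Finset.sum_subset hsub]
      · refine Finset.sum_congr rfl fun m hm ↦ ?_
        simp only [Finset.mem_Ioc] at hm
        rw [hc'def]; dsimp only; rw [if_pos hm.2]
      · intro m _ hm'
        simp only [Finset.mem_Ioc, not_and, not_le] at hm'
        rw [hc'def]; dsimp only
        rw [if_neg (by
          intro hle
          simp only [Finset.mem_Ioc] at *
          omega), zero_mul]
    rw [h1, ZeroDensity.sum_Ioc_mul_two_pow]
  set V : ℝ := 1 / (3 * (J : ℝ)) with hV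
  have hV0 : 0 < V := by positivity
  have hV1 : V ≤ 1 := by
    rw [hV, div_le_one (by positivity)]
    have : (1 : ℝ) ≤ J := by exact_mod_cast hJ1
    linarith
  set Zi : ℕ → Finset ℂ := fun i ↦ Z.filter (fun ρ ↦ V ≤ ‖B i ρ‖) with hZi
  have hcover : Z.filter (fun ρ ↦ 1 / 3 < ‖∑ m ∈ Finset.Ioc X N₀, c m * (m : ℂ) ^ (-ρ)‖) ⊆
      (Finset.range J).biUnion Zi := by
    intro ρ hρ
    rw [Finset.mem_filter] at hρ
    rw [hsplit ρ] at hρ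
    obtain ⟨i, hi, hlarge⟩ := HuxleyZeroDensity.exists_block_large hρ.2
    rw [Finset.mem_biUnion]
    exact ⟨i, hi, by rw [hZi, Finset.mem_filter]; exact ⟨hρ.1, hlarge.le⟩⟩
  set R : ℝ := K * (n * R₀) with hR
  have hR0 : 0 ≤ R := by rw [hR]; positivity
  have hblock : ∀ i ∈ Finset.range J, ((Zi i).card : ℝ) ≤ R := by
    intro i _
    set M : ℕ := X * 2 ^ i with hM
    have hM1 : 1 ≤ M := by rw [hM]; exact Nat.one_le_iff_ne_zero.2 (by positivity)
    have hM0 : (0 : ℝ) < M := by exact_mod_cast hM1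
    have hblk2 : X * 2 ^ (i + 1) = 2 * M := by rw [hM]; ring
    have hXM : X ≤ M := by rw [hM]; exact Nat.le_mul_of_pos_right _ (by positivity)
    by_cases hNM : N₀ ≤ M
    · -- empty block
      have hempty : Zi i = ∅ := by
        rw [Finset.eq_empty_iff_forall_notMem]
        intro ρ hρ
        rw [hZi, Finset.mem_filter] at hρ
        have hB0 : B i ρ = 0 := by
          rw [hBdef]; dsimp only
          refine Finset.sum_eq_zero fun m hm ↦ ?_
          simp only [Finset.mem_Ioc] at hm
          rw [hc'def]; dsimp only
          rw [if_neg (by omega), zero_mul]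
        rw [hB0, norm_zero] at hρ
        linarith [hρ.2]
      rw [hempty, Finset.card_empty, Nat.cast_zero]; exact hR0
    · rw [not_le] at hNM
      obtain ⟨k, hk1, hkK, hkY₁, hkY₂⟩ := hkex M hXM hNM
      have hk0 : (0 : ℝ) < k := by exact_mod_cast hk1
      -- the power polynomial
      set L : ℕ := M ^ k with hL
      have hL1 : 1 ≤ L := by rw [hL]; exact Nat.one_le_pow _ _ hM1
      have hLcast : (L : ℝ) = (M : ℝ) ^ k := by rw [hL]; push_cast; ring
      have h2kL : (2 : ℝ) ^ k * L = (2 * (M : ℝ)) ^ k := by rw [hLcast, mul_pow]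
      have hY₂ge : (2 : ℝ) ^ k * L ≤ Y₂ := by rw [h2kL]; exact hkY₂
      have hY₁L : Y₁ ≤ (L : ℝ) := by rw [hLcast]; exact hkY₁
      set bk : ℕ → ℂ := powCoeff c' M k with hbdef
      -- coefficient bound
      have hf : ∀ m ∈ Finset.Ioc M (2 * M), ‖c' m‖ ≤ C_d * (m : ℝ) ^ θ := fun m _ ↦
        (hc' m).trans (hd m)
      have hb : ∀ r : ℕ, 1 ≤ r → ‖bk r‖ ≤ E * (r : ℝ) ^ η := by
        intro r hr
        have hr1 : (1 : ℝ) ≤ r := by exact_mod_cast hr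
        have h1 := norm_powCoeff_le c' M hCd0 hθ hf hd k hr
        calc ‖bk r‖ ≤ (C_d * C_d) ^ k * (r : ℝ) ^ (2 * k * θ) := h1
          _ ≤ E * (r : ℝ) ^ η := by
              refine mul_le_mul ?_ ?_ (by positivity) (by positivity)
              · rw [hEdef, ← sq]
                exact pow_le_pow_right₀ (one_le_pow₀ hCd1) hkK
              · refine Real.rpow_le_rpow_of_exponent_le hr1 ?_
                have : (2 : ℝ) * k * θ ≤ 2 * K * θ := by
                  have hkK' : (k : ℝ) ≤ K := by exact_mod_cast hkK
                  nlinarith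
                linarith
      -- hypotheses of `dyadicPoly_card_le_gm`
      have hre' : ∀ ρ ∈ Zi i, σ ≤ ρ.re ∧ ρ.re ≤ σ + 1 / 2 := by
        intro ρ hρ
        rw [hZi, Finset.mem_filter] at hρ
        have := hre ρ hρ.1
        exact ⟨this.1, by linarith [this.2]⟩
      have him' : ∀ ρ ∈ Zi i, 0 ≤ ρ.im ∧ ρ.im ≤ T := fun ρ hρ ↦ by
        rw [hZi, Finset.mem_filter] at hρ; exact him ρ hρ.1
      have hsep' : ∀ ρ ∈ Zi i, ∀ ρ' ∈ Zi i, ρ ≠ ρ' → 1 ≤ |ρ.im - ρ'.im| := by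
        intro ρ hρ ρ' hρ' hne
        rw [hZi, Finset.mem_filter] at hρ hρ'
        exact hsep ρ hρ.1 ρ' hρ'.1 hne
      have hlarge' : ∀ ρ ∈ Zi i, V ^ k ≤ ‖∑ r ∈ Finset.Ioc L (L * 2 ^ k), bk r * (r : ℂ) ^ (-ρ)‖ := by
        intro ρ hρ
        rw [hZi, Finset.mem_filter] at hρ
        have h1 : V ≤ ‖∑ m ∈ Finset.Ioc M (2 * M), c' m * (m : ℂ) ^ (-ρ)‖ := by
          have := hρ.2
          rw [hBdef] at this; dsimp only at this
          rwa [hblk2] at this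
        rw [hbdef, hL, ← pow_sum_eq_Ioc c' M ρ hk1, norm_pow]
        exact pow_le_pow_left₀ hV0.le h1 k
      -- `V^k/k ≥ V^K/K`
      have hkK' : (k : ℝ) ≤ K := by exact_mod_cast hkK
      have hVK : V ^ K ≤ V ^ k := pow_le_pow_of_le_one hV0.le hV1 hkK
      have hVk : V ^ K / K ≤ V ^ k / k := by
        rw [div_le_div_iff₀ hK0 hk0]
        exact mul_le_mul hVK hkK' hk0.le (pow_nonneg hV0.le _)
      have hV₀ : V ^ K / K / 4 ≤ V ^ k / k / 4 := by linarith
      have h2n' : 8 * (E * Y₂ ^ η * Y₂) ≤ 2 ^ n * (V ^ k / k) := by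
        have hVKpos : 0 < V ^ K / K := by positivity
        have e : V ^ K / K = ((K : ℝ) * (3 * (J : ℝ)) ^ K)⁻¹ := by
          rw [hV, div_pow, one_pow, mul_inv, one_div]; ring
        have h1 : 8 * (E * Y₂ ^ η * Y₂) ≤ 2 ^ n * (V ^ K / K) := by
          rw [e, ← div_eq_mul_inv, le_div_iff₀ (by positivity)]
          exact h2n
        exact h1.trans (mul_le_mul_of_nonneg_left hVk (by positivity))
      have hD := dyadicPoly_card_le_gm (T := T) hσ hE0 hη hb hL1 hk1 hY₁L hY₂ge (pow_pos hV0 k)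
        hV₀ hn h2n' hblk (Zi i) hre' him' hsep' hlarge'
      calc ((Zi i).card : ℝ) ≤ k * (n * R₀) := hD
        _ ≤ K * (n * R₀) := mul_le_mul_of_nonneg_right hkK' (by positivity)
        _ = R := by rw [hR]
  -- sum over the blocks
  calc ((Z.filter (fun ρ ↦ 1 / 3 < ‖∑ m ∈ Finset.Ioc X N₀, c m * (m : ℂ) ^ (-ρ)‖)).card : ℝ)
      ≤ (((Finset.range J).biUnion Zi).card : ℝ) := by exact_mod_cast Finset.card_le_card hcover
    _ ≤ ∑ i ∈ Finset.range J, ((Zi i).card : ℝ) := by exact_mod_cast Finset.card_biUnion_le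
    _ ≤ ∑ i ∈ Finset.range J, R := Finset.sum_le_sum hblock
    _ = J * R := by rw [Finset.sum_const, Finset.card_range, nsmul_eq_mul]

/-! ## §4. Exponents and the choice of the power -/

/-- **The exponent identities of Guth–Maynard §13.** For `7/10 ≤ σ ≤ 4/5` put
`κ = 15(1−σ)/(3+5σ)`, `a₁ = 10/(6+10σ)`, `a₂ = 15/(6+10σ)` (the window (13.1)
`T^{a₁} ≤ N^k ≤ T^{a₂}`), `α = κ/(18/5 − 4σ)` (so `α(18/5−4σ) = κ`). Then
`a₂(2−2σ) = κ` (the term `N^{2k(1−σ)}`), `1 + a₁(12/5 − 4σ) = κ` (the term `TN^{(12/5−4σ)k}`),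
`1 + α(1−2σ) ≤ κ` (the mean value bound when `N^k > T^α`; Guth–Maynard:
`1 + (1−2σ)α = κ − (250(σ−3/4)² + 3/8)/(2(3+5σ)(9−10σ))`), `2 − 2σ ≤ κ` (the Type II zeros,
`σ ≤ 9/10`), `2a₂ = 3a₁`, and the ranges `0 < κ ≤ 7/10`, `7/10 ≤ a₁ ≤ 4/5`, `1 < a₂ ≤ 6/5`,
`0 < α`, `2/5 ≤ 18/5 − 4σ`. [cite: GuthMaynard2026, Section 13, (13.1) and proof of Theorem 1.2] -/
theorem gm_exponents {σ : ℝ} (h₀ : 7 / 10 ≤ σ) (h₁ : σ ≤ 4 / 5) :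
    15 / (6 + 10 * σ) * (2 - 2 * σ) = 15 * (1 - σ) / (3 + 5 * σ) ∧
      1 + 10 / (6 + 10 * σ) * (12 / 5 - 4 * σ) = 15 * (1 - σ) / (3 + 5 * σ) ∧
      1 + 15 * (1 - σ) / (3 + 5 * σ) / (18 / 5 - 4 * σ) * (1 - 2 * σ) ≤
        15 * (1 - σ) / (3 + 5 * σ) ∧
      2 - 2 * σ ≤ 15 * (1 - σ) / (3 + 5 * σ) ∧
      2 * (15 / (6 + 10 * σ)) = 3 * (10 / (6 + 10 * σ)) ∧
      (0 < 15 * (1 - σ) / (3 + 5 * σ) ∧ 15 * (1 - σ) / (3 + 5 * σ) ≤ 7 / 10) ∧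
      (7 / 10 ≤ 10 / (6 + 10 * σ) ∧ 10 / (6 + 10 * σ) ≤ 4 / 5) ∧
      (1 < 15 / (6 + 10 * σ) ∧ 15 / (6 + 10 * σ) ≤ 6 / 5) ∧
      0 < 15 * (1 - σ) / (3 + 5 * σ) / (18 / 5 - 4 * σ) ∧
      2 / 5 ≤ 18 / 5 - 4 * σ := by
  have hs : 0 < 3 + 5 * σ := by linarith
  have hs2 : 0 < 6 + 10 * σ := by linarith
  have hd : 0 < 18 / 5 - 4 * σ := by linarith
  refine ⟨?_, ?_, ?_, ?_, ?_, ⟨?_, ?_⟩, ⟨?_, ?_⟩, ⟨?_, ?_⟩, ?_, ?_⟩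
  · field_simp; ring
  · field_simp; ring
  · -- `1 + α(1−2σ) ≤ κ`
    have e : 15 * (1 - σ) / (3 + 5 * σ) / (18 / 5 - 4 * σ) * (1 - 2 * σ) =
        15 * (1 - σ) * (1 - 2 * σ) / ((3 + 5 * σ) * (18 / 5 - 4 * σ)) := by
      field_simp
    have h0 : (3 + 5 * σ) * (18 / 5 - 4 * σ) + 15 * (1 - σ) * (1 - 2 * σ) ≤
        15 * (1 - σ) * (18 / 5 - 4 * σ) := by
      nlinarith [sq_nonneg (σ - 3 / 4)]
    have hsd : 0 < (3 + 5 * σ) * (18 / 5 - 4 * σ) := by positivity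
    rw [e]
    calc 1 + 15 * (1 - σ) * (1 - 2 * σ) / ((3 + 5 * σ) * (18 / 5 - 4 * σ))
        = ((3 + 5 * σ) * (18 / 5 - 4 * σ) + 15 * (1 - σ) * (1 - 2 * σ)) /
            ((3 + 5 * σ) * (18 / 5 - 4 * σ)) := by
          rw [one_add_div hsd.ne']
      _ ≤ 15 * (1 - σ) * (18 / 5 - 4 * σ) / ((3 + 5 * σ) * (18 / 5 - 4 * σ)) :=
          (div_le_div_iff_of_pos_right hsd).2 h0
      _ = 15 * (1 - σ) / (3 + 5 * σ) := by
          rw [mul_div_mul_right _ _ hd.ne']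
  · rw [le_div_iff₀ hs]; nlinarith
  · field_simp; ring
  · exact div_pos (by linarith) hs
  · rw [div_le_iff₀ hs]; nlinarith
  · rw [le_div_iff₀ hs2]; nlinarith
  · rw [div_le_iff₀ hs2]; nlinarith
  · rw [lt_div_iff₀ hs2]; nlinarith
  · rw [div_le_iff₀ hs2]; nlinarith
  · exact div_pos (div_pos (by linarith) hs) hd
  · linarith

/-- **The choice of the power `k`** (Guth–Maynard (13.1): "we can choose `k ≪ 1` such that
`T^{10/(6+10σ)} ≤ N^k ≤ T^{15/(6+10σ)}`; this is clearly possible if `N ≤ T^{5/(6+10σ)}`,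
whereas if `N > T^{5/(6+10σ)}` we can take `k = 2`"). In logarithms: if `0 < ηl ≤ m`,
`2m ≤ (1+η)l`, `0 < a₁ ≤ 1`, `1 ≤ a₂`, `3a₁ ≤ 2a₂` and `1/η + 1 ≤ K`, there is `1 ≤ k ≤ K` with
`a₁ l ≤ k m ≤ (a₂ + η) l`. [cite: GuthMaynard2026, Section 13, (13.1)] -/
theorem exists_power_gm {η l m a₁ a₂ : ℝ} (hη : 0 < η) (hl : 0 < l) (hm : η * l ≤ m)
    (hmup : 2 * m ≤ (1 + η) * l) (ha₁ : 0 < a₁) (ha₁1 : a₁ ≤ 1) (ha₂ : 1 ≤ a₂)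
    (h32 : 3 * a₁ ≤ 2 * a₂) {K : ℕ} (hK : 1 / η + 1 ≤ K) :
    ∃ k : ℕ, 1 ≤ k ∧ k ≤ K ∧ a₁ * l ≤ k * m ∧ (k : ℝ) * m ≤ (a₂ + η) * l := by
  have hm0 : 0 < m := lt_of_lt_of_le (by positivity) hm
  have hK2 : (2 : ℝ) ≤ K := by
    have : (1 : ℝ) ≤ 1 / η := by rw [le_div_iff₀ hη]; nlinarith
    linarith
  rcases le_or_gt m ((a₂ + η - a₁) * l) with hcase | hcase
  · -- `k = ⌈a₁ l / m⌉`
    set k : ℕ := ⌈a₁ * l / m⌉₊ with hk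
    have hq0 : 0 < a₁ * l / m := by positivity
    have hk1 : a₁ * l / m ≤ k := Nat.le_ceil _
    have hk2 : (k : ℝ) < a₁ * l / m + 1 := Nat.ceil_lt_add_one hq0.le
    have hkpos : 1 ≤ k := by
      have : (0 : ℝ) < k := lt_of_lt_of_le hq0 hk1
      exact_mod_cast this
    refine ⟨k, hkpos, ?_, ?_, ?_⟩
    · have h1 : a₁ * l / m ≤ 1 / η := by
        rw [div_le_div_iff₀ hm0 hη]
        calc a₁ * l * η ≤ 1 * l * η := by gcongr
          _ = η * l := by ring
          _ ≤ m := hm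
          _ = 1 * m := (one_mul m).symm
      have : (k : ℝ) ≤ K := by linarith
      exact_mod_cast this
    · rwa [div_le_iff₀ hm0] at hk1
    · have : (k : ℝ) * m < (a₁ * l / m + 1) * m := mul_lt_mul_of_pos_right hk2 hm0
      rw [add_mul, div_mul_cancel₀ _ hm0.ne', one_mul] at this
      linarith
  · -- `k = 2`
    refine ⟨2, by norm_num, ?_, ?_, ?_⟩
    · exact_mod_cast hK2
    · push_cast; nlinarith
    · push_cast; nlinarith

/-! ## §5. The count on one block, made explicit -/

/-- `(x^a)^n = x^{n a}` for real `x ≥ 0` and natural `n`, in the form used below. [folklore] -/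
theorem rpow_pow_eq {x a : ℝ} (hx : 0 ≤ x) (n : ℕ) : (x ^ a) ^ n = x ^ ((n : ℝ) * a) := by
  rw [← Real.rpow_natCast (x ^ a), ← Real.rpow_mul hx]; ring_nf

set_option maxHeartbeats 1000000 in
/-- **The count on one block** (the case analysis of Guth–Maynard §13 after (13.1): the large
values estimate when `N^k ≤ T^α` — each of the three terms is `≲ T^κ` by the upper bound of
(13.1), by `N^k ≤ T^α`, and by the lower bound of (13.1) — and the mean value theorem when
`N^k > T^α`, where `1 + (1−2σ)α ≤ κ`; blocks longer than `T` are also counted by the mean value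
theorem). With `Y₁ = T^{a₁}`, `Y₂ = 2^K T^{a₂+η}`, a block `(P, 2P]`, `Y₁ ≤ P`, `2P ≤ Y₂`,
coefficients `|a(r)| ≤ E Y₂^η P^{-σ}`, a threshold `V ≥ (3J)^{-K}/(4K)` (`J ≤ 17 log T`) and the
large values bound with constant `C₁ T^η` at this `T`, every `1`-separated set of reals
`t ∈ [0, T]` with `|∑_{P<r≤2P} a(r) r^{-it}| ≥ V` has at most
`(3·2^K C₁ Q₁⁴ + 44(K+3)2^K Q₁²) log^{4K+1} T · T^{κ+10η}` elements, `Q₁ = 4K·51^K·2^K·E`.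
[cite: GuthMaynard2026, Section 13, proof of Theorem 1.2] -/
theorem block_count_gm {T l σ η κ α C₁ E Y₁ Y₂ : ℝ} {K J : ℕ} (hT1 : 1 ≤ T)
    (hl : l = Real.log T) (hl1 : 1 ≤ l) (hη : 0 < η) (hη1 : η ≤ 1 / 100) (hσ : 7 / 10 ≤ σ)
    (hσ1 : σ ≤ 4 / 5) (hκ : κ = 15 * (1 - σ) / (3 + 5 * σ))
    (hα : α = 15 * (1 - σ) / (3 + 5 * σ) / (18 / 5 - 4 * σ)) (hC₁ : 0 ≤ C₁) (hE1 : 1 ≤ E)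
    (hK1 : 1 ≤ K) (hJ1 : 1 ≤ J) (hJ17 : (J : ℝ) ≤ 17 * l)
    (hY₁def : Y₁ = T ^ (10 / (6 + 10 * σ))) (hY₂def : Y₂ = 2 ^ K * T ^ (15 / (6 + 10 * σ) + η))
    (hLVT : ∀ (N : ℕ) (b : ℕ → ℂ) (V : ℝ) (W : Finset ℝ), 1 ≤ N → (N : ℝ) ≤ T →
      (∀ n, ‖b n‖ ≤ 1) → 0 < V → (∀ t ∈ W, 0 ≤ t ∧ t ≤ T) →
      (∀ t ∈ W, ∀ t' ∈ W, t ≠ t' → 1 ≤ |t - t'|) →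
      (∀ t ∈ W, V ≤ ‖∑ n ∈ Finset.Icc N (2 * N), b n * (n : ℂ) ^ ((t : ℂ) * I)‖) →
      (W.card : ℝ) ≤ C₁ * T ^ η * ((N : ℝ) ^ 2 * V⁻¹ ^ 2 + (N : ℝ) ^ (18 / 5 : ℝ) * V⁻¹ ^ 4 +
        T * (N : ℝ) ^ (12 / 5 : ℝ) * V⁻¹ ^ 4))
    {P : ℕ} {a : ℕ → ℂ} {V : ℝ} {W : Finset ℝ} (hP : 1 ≤ P) (hY₁P : Y₁ ≤ (P : ℝ))
    (h2P : 2 * (P : ℝ) ≤ Y₂)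
    (ha : ∀ r ∈ Finset.Ioc P (2 * P), ‖a r‖ ≤ E * Y₂ ^ η * (P : ℝ) ^ (-σ))
    (hV : (1 / (3 * (J : ℝ))) ^ K / K / 4 ≤ V)
    (hW : ∀ t ∈ W, 0 ≤ t ∧ t ≤ T) (hsep : ∀ t ∈ W, ∀ t' ∈ W, t ≠ t' → 1 ≤ |t - t'|)
    (hlarge : ∀ t ∈ W, V ≤ ‖∑ r ∈ Finset.Ioc P (2 * P), a r * (r : ℂ) ^ (-((t : ℂ) * I))‖) :
    (W.card : ℝ) ≤ (3 * 2 ^ K * C₁ * (4 * K * 51 ^ K * 2 ^ K * E) ^ 4 +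
        44 * (K + 3) * 2 ^ K * (4 * K * 51 ^ K * 2 ^ K * E) ^ 2) *
      (l ^ (4 * K + 1) * T ^ (κ + 10 * η)) := by
  -- ### basic quantities
  obtain ⟨E1, E3, E4, -, -, ⟨hκ0, hκ1⟩, ⟨ha₁0, ha₁1⟩, ⟨ha₂0, ha₂1⟩, hα0, hd⟩ := gm_exponents hσ hσ1
  set a₁ : ℝ := 10 / (6 + 10 * σ) with ha₁
  set a₂ : ℝ := 15 / (6 + 10 * σ) with ha₂
  rw [← hκ] at E1 E3 hκ0 hκ1
  rw [← hα, ← hκ] at E4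
  rw [← hα] at hα0
  have E2 : α * (18 / 5 - 4 * σ) = κ := by rw [hα, hκ]; exact div_mul_cancel₀ _ (by linarith)
  have hT0 : 0 < T := by linarith
  have hl0 : 0 < l := by linarith
  have hP0 : (0 : ℝ) < P := by exact_mod_cast hP
  have hP1 : (1 : ℝ) ≤ P := by exact_mod_cast hP
  have hK0 : (0 : ℝ) < K := by exact_mod_cast hK1
  have hJ0 : (0 : ℝ) < J := by exact_mod_cast hJ1
  have h2K1 : (1 : ℝ) ≤ 2 ^ K := one_le_pow₀ (by norm_num)
  have hE0 : 0 < E := by linarith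
  have hTpow : ∀ e : ℝ, T ^ e = Real.exp (e * l) := fun e ↦ by
    rw [hl, Real.rpow_def_of_pos hT0]; ring_nf
  have hTmono : ∀ e f : ℝ, e ≤ f → T ^ e ≤ T ^ f := fun e f h ↦
    Real.rpow_le_rpow_of_exponent_le hT1 h
  have hTge1 : ∀ e : ℝ, 0 ≤ e → 1 ≤ T ^ e := fun e he ↦ Real.one_le_rpow hT1 he
  have hY₂1 : 1 ≤ Y₂ := by
    rw [hY₂def]; exact one_le_mul_of_one_le_of_one_le h2K1 (hTge1 _ (by linarith))
  have hY₂0 : 0 < Y₂ := by linarith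
  have hPY₂ : (P : ℝ) ≤ Y₂ := by linarith
  -- `V`
  set V₀ : ℝ := (1 / (3 * (J : ℝ))) ^ K / K / 4 with hV₀
  have hV₀0 : 0 < V₀ := by positivity
  have hV0 : 0 < V := lt_of_lt_of_le hV₀0 hV
  have hK1' : (1 : ℝ) ≤ K := by exact_mod_cast hK1
  have hVinv : V⁻¹ ≤ 4 * K * (51 * l) ^ K := by
    have e : V₀⁻¹ = 4 * K * (3 * (J : ℝ)) ^ K := by
      rw [hV₀, div_pow, one_pow, div_div, div_div, one_div, inv_inv]; ring
    have h1 : V⁻¹ ≤ V₀⁻¹ := by rw [inv_le_inv₀ hV0 hV₀0]; exact hV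
    rw [e] at h1
    refine h1.trans (mul_le_mul_of_nonneg_left (pow_le_pow_left₀ (by positivity) ?_ K)
      (by positivity))
    linarith
  -- `Y₂^η ≤ 2^K T^{2η}`
  have hY₂η : Y₂ ^ η ≤ 2 ^ K * T ^ (2 * η) := by
    rw [hY₂def, Real.mul_rpow (by positivity) (by positivity), ← Real.rpow_mul hT0.le]
    refine mul_le_mul ?_ (hTmono _ _ (by nlinarith)) (by positivity) (by positivity)
    calc ((2 : ℝ) ^ K) ^ η ≤ ((2 : ℝ) ^ K) ^ (1 : ℝ) :=
          Real.rpow_le_rpow_of_exponent_le h2K1 (by linarith)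
      _ = 2 ^ K := Real.rpow_one _
  -- the normalised coefficient size `A/V ≤ Qb P^{-σ}`
  set A : ℝ := E * Y₂ ^ η * (P : ℝ) ^ (-σ) with hA
  have hA0 : 0 < A := by positivity
  set Q₁ : ℝ := 4 * K * 51 ^ K * 2 ^ K * E with hQ₁
  set Qb : ℝ := Q₁ * l ^ K * T ^ (2 * η) with hQb
  have hQ₁1 : 1 ≤ Q₁ := by
    rw [hQ₁]
    have h1 : (1 : ℝ) ≤ 4 * K := by linarith [hK1']
    have h2 : (1 : ℝ) ≤ 51 ^ K := one_le_pow₀ (by norm_num)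
    calc (1 : ℝ) = 1 * 1 * 1 * 1 := by ring
      _ ≤ 4 * K * 51 ^ K * 2 ^ K * E := by gcongr
  have hQb1 : 1 ≤ Qb := by
    rw [hQb]
    exact one_le_mul_of_one_le_of_one_le (one_le_mul_of_one_le_of_one_le hQ₁1 (one_le_pow₀ hl1))
      (hTge1 _ (by positivity))
  have hQb0 : 0 < Qb := by linarith
  have hAV : A / V ≤ Qb * (P : ℝ) ^ (-σ) := by
    rw [div_eq_mul_inv, hA]
    have h1 : E * Y₂ ^ η * (P : ℝ) ^ (-σ) * V⁻¹ = (E * Y₂ ^ η * V⁻¹) * (P : ℝ) ^ (-σ) := by ring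
    rw [h1]
    refine mul_le_mul_of_nonneg_right ?_ (by positivity)
    calc E * Y₂ ^ η * V⁻¹ ≤ E * (2 ^ K * T ^ (2 * η)) * (4 * K * (51 * l) ^ K) := by gcongr
      _ = Qb := by rw [hQb, hQ₁, mul_pow]; ring
  have hAV0 : 0 ≤ A / V := by positivity
  have hAV2 : (A / V) ^ 2 ≤ Qb ^ 2 * (P : ℝ) ^ (-(2 * σ)) := by
    calc (A / V) ^ 2 ≤ (Qb * (P : ℝ) ^ (-σ)) ^ 2 := pow_le_pow_left₀ hAV0 hAV 2
      _ = Qb ^ 2 * ((P : ℝ) ^ (-σ)) ^ 2 := mul_pow _ _ _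
      _ = Qb ^ 2 * (P : ℝ) ^ (-(2 * σ)) := by rw [rpow_pow_eq hP0.le]; norm_num
  have hAV4 : (A / V) ^ 4 ≤ Qb ^ 4 * (P : ℝ) ^ (-(4 * σ)) := by
    calc (A / V) ^ 4 ≤ (Qb * (P : ℝ) ^ (-σ)) ^ 4 := pow_le_pow_left₀ hAV0 hAV 4
      _ = Qb ^ 4 * ((P : ℝ) ^ (-σ)) ^ 4 := mul_pow _ _ _
      _ = Qb ^ 4 * (P : ℝ) ^ (-(4 * σ)) := by rw [rpow_pow_eq hP0.le]; norm_num
  have hQb2 : Qb ^ 2 ≤ Qb ^ 4 := pow_le_pow_right₀ hQb1 (by norm_num)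
  -- ### the three monomials in `P`
  -- `P^{2−2σ} ≤ 2^K T^{κ+η}`
  have hP22 : (P : ℝ) ^ (2 - 2 * σ) ≤ 2 ^ K * T ^ (κ + η) := by
    have h1 : (P : ℝ) ^ (2 - 2 * σ) ≤ Y₂ ^ (2 - 2 * σ) :=
      Real.rpow_le_rpow hP0.le hPY₂ (by linarith)
    refine h1.trans ?_
    rw [hY₂def, Real.mul_rpow (by positivity) (by positivity), ← Real.rpow_mul hT0.le]
    refine mul_le_mul ?_ (hTmono _ _ ?_) (by positivity) (by positivity)
    · calc ((2 : ℝ) ^ K) ^ (2 - 2 * σ) ≤ ((2 : ℝ) ^ K) ^ (1 : ℝ) :=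
            Real.rpow_le_rpow_of_exponent_le h2K1 (by linarith)
        _ = 2 ^ K := Real.rpow_one _
    · have e : (a₂ + η) * (2 - 2 * σ) = a₂ * (2 - 2 * σ) + η * (2 - 2 * σ) := by ring
      have : η * (2 - 2 * σ) ≤ η * 1 := mul_le_mul_of_nonneg_left (by linarith) hη.le
      rw [e, E1]; linarith
  -- `P ≤ T^α → P^{18/5−4σ} ≤ T^κ`
  have hP18 : (P : ℝ) ≤ T ^ α → (P : ℝ) ^ (18 / 5 - 4 * σ) ≤ T ^ κ := by
    intro hPα
    calc (P : ℝ) ^ (18 / 5 - 4 * σ) ≤ (T ^ α) ^ (18 / 5 - 4 * σ) :=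
          Real.rpow_le_rpow hP0.le hPα (by linarith)
      _ = T ^ κ := by rw [← Real.rpow_mul hT0.le, E2]
  -- `T P^{12/5−4σ} ≤ T^κ`
  have hP12 : T * (P : ℝ) ^ (12 / 5 - 4 * σ) ≤ T ^ κ := by
    have hY₁0 : 0 < Y₁ := by rw [hY₁def]; positivity
    have h1 : (P : ℝ) ^ (12 / 5 - 4 * σ) ≤ Y₁ ^ (12 / 5 - 4 * σ) :=
      Real.rpow_le_rpow_of_nonpos hY₁0 hY₁P (by linarith)
    calc T * (P : ℝ) ^ (12 / 5 - 4 * σ) ≤ T * Y₁ ^ (12 / 5 - 4 * σ) :=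
          mul_le_mul_of_nonneg_left h1 hT0.le
      _ = T ^ (1 : ℝ) * T ^ (a₁ * (12 / 5 - 4 * σ)) := by
          rw [Real.rpow_one, hY₁def, ← Real.rpow_mul hT0.le]
      _ = T ^ κ := by rw [← Real.rpow_add hT0, E3]
  -- `T^α < P → T P^{1−2σ} ≤ T^κ`
  have hP1σ : T ^ α < (P : ℝ) → T * (P : ℝ) ^ (1 - 2 * σ) ≤ T ^ κ := by
    intro hPα
    have h1 : (P : ℝ) ^ (1 - 2 * σ) ≤ (T ^ α) ^ (1 - 2 * σ) :=
      Real.rpow_le_rpow_of_nonpos (by positivity) hPα.le (by linarith)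
    calc T * (P : ℝ) ^ (1 - 2 * σ) ≤ T * (T ^ α) ^ (1 - 2 * σ) :=
          mul_le_mul_of_nonneg_left h1 hT0.le
      _ = T ^ (1 + α * (1 - 2 * σ)) := by
          rw [← Real.rpow_mul hT0.le, Real.rpow_add hT0, Real.rpow_one]
      _ ≤ T ^ κ := hTmono _ _ E4
  have hTκ : T ^ κ ≤ 2 ^ K * T ^ (κ + η) := by
    calc T ^ κ = 1 * T ^ κ := (one_mul _).symm
      _ ≤ 2 ^ K * T ^ (κ + η) := mul_le_mul h2K1 (hTmono _ _ (by linarith)) (by positivity)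
          (by positivity)
  -- ### powers of `l` and `T`
  have hQb4 : Qb ^ 4 = Q₁ ^ 4 * l ^ (4 * K) * T ^ (8 * η) := by
    rw [hQb, mul_pow, mul_pow, ← pow_mul, rpow_pow_eq hT0.le]; push_cast; ring_nf
  have hQb2' : Qb ^ 2 = Q₁ ^ 2 * l ^ (2 * K) * T ^ (4 * η) := by
    rw [hQb, mul_pow, mul_pow, ← pow_mul, rpow_pow_eq hT0.le]; push_cast; ring_nf
  have hl4K : l ^ (4 * K) ≤ l ^ (4 * K + 1) := pow_le_pow_right₀ hl1 (by omega)
  have hl2K : l ^ (2 * K) * l ≤ l ^ (4 * K + 1) := by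
    rw [← pow_succ]; exact pow_le_pow_right₀ hl1 (by omega)
  -- ### the two cases
  by_cases hcase : (P : ℝ) ≤ T ∧ (P : ℝ) ≤ T ^ α
  · -- ### the large values estimate
    obtain ⟨hPT, hPα⟩ := hcase
    have hLV := realPoints_count_LV (T := T) (C₁ := C₁ * T ^ η) hLVT hP hPT hA0 ha hV0 W
      hW hsep hlarge
    have hmain : (P : ℝ) ^ 2 * (A / V) ^ 2 + (P : ℝ) ^ (18 / 5 : ℝ) * (A / V) ^ 4 +
        T * (P : ℝ) ^ (12 / 5 : ℝ) * (A / V) ^ 4 ≤ 3 * (Qb ^ 4 * (2 ^ K * T ^ (κ + η))) := by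
      -- first term
      have t1 : (P : ℝ) ^ 2 * (A / V) ^ 2 ≤ Qb ^ 4 * (2 ^ K * T ^ (κ + η)) := by
        have e : (P : ℝ) ^ 2 * (P : ℝ) ^ (-(2 * σ)) = (P : ℝ) ^ (2 - 2 * σ) := by
          rw [← Real.rpow_two, ← Real.rpow_add hP0]; ring_nf
        calc (P : ℝ) ^ 2 * (A / V) ^ 2 ≤ (P : ℝ) ^ 2 * (Qb ^ 2 * (P : ℝ) ^ (-(2 * σ))) :=
              mul_le_mul_of_nonneg_left hAV2 (by positivity)
          _ = Qb ^ 2 * ((P : ℝ) ^ 2 * (P : ℝ) ^ (-(2 * σ))) := by ring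
          _ = Qb ^ 2 * (P : ℝ) ^ (2 - 2 * σ) := by rw [e]
          _ ≤ Qb ^ 4 * (2 ^ K * T ^ (κ + η)) :=
              mul_le_mul hQb2 hP22 (by positivity) (by positivity)
      -- second term
      have t2 : (P : ℝ) ^ (18 / 5 : ℝ) * (A / V) ^ 4 ≤ Qb ^ 4 * (2 ^ K * T ^ (κ + η)) := by
        have e : (P : ℝ) ^ (18 / 5 : ℝ) * (P : ℝ) ^ (-(4 * σ)) = (P : ℝ) ^ (18 / 5 - 4 * σ) := by
          rw [← Real.rpow_add hP0]; ring_nf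
        calc (P : ℝ) ^ (18 / 5 : ℝ) * (A / V) ^ 4
            ≤ (P : ℝ) ^ (18 / 5 : ℝ) * (Qb ^ 4 * (P : ℝ) ^ (-(4 * σ))) :=
              mul_le_mul_of_nonneg_left hAV4 (by positivity)
          _ = Qb ^ 4 * ((P : ℝ) ^ (18 / 5 : ℝ) * (P : ℝ) ^ (-(4 * σ))) := by ring
          _ = Qb ^ 4 * (P : ℝ) ^ (18 / 5 - 4 * σ) := by rw [e]
          _ ≤ Qb ^ 4 * T ^ κ := mul_le_mul_of_nonneg_left (hP18 hPα) (by positivity)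
          _ ≤ Qb ^ 4 * (2 ^ K * T ^ (κ + η)) := mul_le_mul_of_nonneg_left hTκ (by positivity)
      -- third term
      have t3 : T * (P : ℝ) ^ (12 / 5 : ℝ) * (A / V) ^ 4 ≤ Qb ^ 4 * (2 ^ K * T ^ (κ + η)) := by
        have e : (P : ℝ) ^ (12 / 5 : ℝ) * (P : ℝ) ^ (-(4 * σ)) = (P : ℝ) ^ (12 / 5 - 4 * σ) := by
          rw [← Real.rpow_add hP0]; ring_nf
        calc T * (P : ℝ) ^ (12 / 5 : ℝ) * (A / V) ^ 4
            ≤ T * (P : ℝ) ^ (12 / 5 : ℝ) * (Qb ^ 4 * (P : ℝ) ^ (-(4 * σ))) :=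
              mul_le_mul_of_nonneg_left hAV4 (by positivity)
          _ = Qb ^ 4 * (T * ((P : ℝ) ^ (12 / 5 : ℝ) * (P : ℝ) ^ (-(4 * σ)))) := by ring
          _ = Qb ^ 4 * (T * (P : ℝ) ^ (12 / 5 - 4 * σ)) := by rw [e]
          _ ≤ Qb ^ 4 * T ^ κ := mul_le_mul_of_nonneg_left hP12 (by positivity)
          _ ≤ Qb ^ 4 * (2 ^ K * T ^ (κ + η)) := mul_le_mul_of_nonneg_left hTκ (by positivity)
      calc (P : ℝ) ^ 2 * (A / V) ^ 2 + (P : ℝ) ^ (18 / 5 : ℝ) * (A / V) ^ 4 +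
          T * (P : ℝ) ^ (12 / 5 : ℝ) * (A / V) ^ 4
          ≤ Qb ^ 4 * (2 ^ K * T ^ (κ + η)) + Qb ^ 4 * (2 ^ K * T ^ (κ + η)) +
            Qb ^ 4 * (2 ^ K * T ^ (κ + η)) := add_le_add (add_le_add t1 t2) t3
        _ = 3 * (Qb ^ 4 * (2 ^ K * T ^ (κ + η))) := by ring
    have hTT : T ^ η * (T ^ (8 * η) * T ^ (κ + η)) = T ^ (κ + 10 * η) := by
      rw [← Real.rpow_add hT0, ← Real.rpow_add hT0]; ring_nf
    calc (W.card : ℝ) ≤ C₁ * T ^ η * ((P : ℝ) ^ 2 * (A / V) ^ 2 + (P : ℝ) ^ (18 / 5 : ℝ) * (A / V) ^ 4 +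
          T * (P : ℝ) ^ (12 / 5 : ℝ) * (A / V) ^ 4) := hLV
      _ ≤ C₁ * T ^ η * (3 * (Qb ^ 4 * (2 ^ K * T ^ (κ + η)))) :=
          mul_le_mul_of_nonneg_left hmain (by positivity)
      _ = 3 * 2 ^ K * C₁ * Q₁ ^ 4 * (l ^ (4 * K) * (T ^ η * (T ^ (8 * η) * T ^ (κ + η)))) := by
          rw [hQb4]; ring
      _ = 3 * 2 ^ K * C₁ * Q₁ ^ 4 * (l ^ (4 * K) * T ^ (κ + 10 * η)) := by rw [hTT]
      _ ≤ 3 * 2 ^ K * C₁ * Q₁ ^ 4 * (l ^ (4 * K + 1) * T ^ (κ + 10 * η)) := by gcongr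
      _ ≤ (3 * 2 ^ K * C₁ * Q₁ ^ 4 + 44 * (K + 3) * 2 ^ K * Q₁ ^ 2) *
            (l ^ (4 * K + 1) * T ^ (κ + 10 * η)) :=
          mul_le_mul_of_nonneg_right (le_add_of_nonneg_right (by positivity)) (by positivity)
  · -- ### the mean value theorem
    have hMVT := realPoints_count_MVT hT1 hP ha hV0 W hW hsep hlarge
    -- `(A/V)² P (5T + 3 + 36P) ≤ 44 Qb² 2^K T^{κ+η}`
    have hgeom : (A / V) ^ 2 * P * (5 * T + 3 + 36 * P) ≤ 44 * (Qb ^ 2 * (2 ^ K * T ^ (κ + η))) := by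
      have e1 : (P : ℝ) ^ (-(2 * σ)) * P = (P : ℝ) ^ (1 - 2 * σ) := by
        conv_lhs => rw [show (P : ℝ) ^ (-(2 * σ)) * P = (P : ℝ) ^ (-(2 * σ)) * (P : ℝ) ^ (1 : ℝ) by
          rw [Real.rpow_one]]
        rw [← Real.rpow_add hP0]; ring_nf
      have h1 : (A / V) ^ 2 * P * (5 * T + 3 + 36 * P) ≤
          Qb ^ 2 * ((P : ℝ) ^ (1 - 2 * σ) * (5 * T + 3 + 36 * P)) := by
        calc (A / V) ^ 2 * P * (5 * T + 3 + 36 * P)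
            ≤ (Qb ^ 2 * (P : ℝ) ^ (-(2 * σ))) * P * (5 * T + 3 + 36 * P) := by
              gcongr
          _ = Qb ^ 2 * (((P : ℝ) ^ (-(2 * σ)) * P) * (5 * T + 3 + 36 * P)) := by ring
          _ = Qb ^ 2 * ((P : ℝ) ^ (1 - 2 * σ) * (5 * T + 3 + 36 * P)) := by rw [e1]
      have h2 : (P : ℝ) ^ (1 - 2 * σ) * (5 * T + 3 + 36 * P) ≤ 44 * (2 ^ K * T ^ (κ + η)) := by
        rcases le_or_gt T P with hTP | hTP
        · -- `T ≤ P`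
          have e2 : (P : ℝ) ^ (1 - 2 * σ) * P = (P : ℝ) ^ (2 - 2 * σ) := by
            conv_lhs => rw [show (P : ℝ) ^ (1 - 2 * σ) * P = (P : ℝ) ^ (1 - 2 * σ) * (P : ℝ) ^ (1 : ℝ)
              by rw [Real.rpow_one]]
            rw [← Real.rpow_add hP0]; ring_nf
          calc (P : ℝ) ^ (1 - 2 * σ) * (5 * T + 3 + 36 * P) ≤ (P : ℝ) ^ (1 - 2 * σ) * (44 * P) :=
                mul_le_mul_of_nonneg_left (by linarith) (by positivity)
            _ = 44 * ((P : ℝ) ^ (1 - 2 * σ) * P) := by ring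
            _ = 44 * (P : ℝ) ^ (2 - 2 * σ) := by rw [e2]
            _ ≤ 44 * (2 ^ K * T ^ (κ + η)) := by linarith [hP22]
        · -- `P < T`, hence `T^α < P`
          have hPα : T ^ α < (P : ℝ) := by
            by_contra h
            exact hcase ⟨hTP.le, not_lt.1 h⟩
          calc (P : ℝ) ^ (1 - 2 * σ) * (5 * T + 3 + 36 * P) ≤ (P : ℝ) ^ (1 - 2 * σ) * (44 * T) :=
                mul_le_mul_of_nonneg_left (by linarith) (by positivity)
            _ = 44 * (T * (P : ℝ) ^ (1 - 2 * σ)) := by ring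
            _ ≤ 44 * T ^ κ := by linarith [hP1σ hPα]
            _ ≤ 44 * (2 ^ K * T ^ (κ + η)) := by linarith [hTκ]
      calc (A / V) ^ 2 * P * (5 * T + 3 + 36 * P)
          ≤ Qb ^ 2 * ((P : ℝ) ^ (1 - 2 * σ) * (5 * T + 3 + 36 * P)) := h1
        _ ≤ Qb ^ 2 * (44 * (2 ^ K * T ^ (κ + η))) := mul_le_mul_of_nonneg_left h2 (by positivity)
        _ = 44 * (Qb ^ 2 * (2 ^ K * T ^ (κ + η))) := by ring
    -- `1 + log(2P) ≤ (K + 3) l`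
    have hlogb : 1 + Real.log (2 * (P : ℝ)) ≤ (K + 3) * l := by
      have h1 : Real.log (2 * (P : ℝ)) ≤ Real.log Y₂ := Real.log_le_log (by positivity) h2P
      have h2 : Real.log Y₂ = K * Real.log 2 + (a₂ + η) * l := by
        rw [hY₂def, Real.log_mul (by positivity) (by positivity), Real.log_pow,
          Real.log_rpow hT0, ← hl]
      have hlog2 : Real.log 2 ≤ 1 := by have := Real.log_two_lt_d9; linarith
      have h3 : (K : ℝ) * Real.log 2 ≤ K := mul_le_of_le_one_right hK0.le hlog2
      have h4 : (a₂ + η) * l ≤ 2 * l := mul_le_mul_of_nonneg_right (by linarith) hl0.le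
      have h5 : (1 : ℝ) + K ≤ (K + 1) * l := by
        have := mul_le_mul_of_nonneg_left hl1 (show (0 : ℝ) ≤ K + 1 by positivity)
        rw [mul_one] at this
        linarith
      calc 1 + Real.log (2 * (P : ℝ)) ≤ 1 + Real.log Y₂ := by linarith
        _ = 1 + ((K : ℝ) * Real.log 2 + (a₂ + η) * l) := by rw [h2]
        _ ≤ 1 + (K + 2 * l) := by linarith
        _ = (1 + K) + 2 * l := by ring
        _ ≤ (K + 1) * l + 2 * l := by linarith
        _ = (K + 3) * l := by ring
    have hlog0 : 0 ≤ 1 + Real.log (2 * (P : ℝ)) := by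
      have : 0 ≤ Real.log (2 * (P : ℝ)) := Real.log_nonneg (by linarith)
      linarith
    have hTT : T ^ (4 * η) * T ^ (κ + η) ≤ T ^ (κ + 10 * η) := by
      rw [← Real.rpow_add hT0]; exact hTmono _ _ (by linarith)
    calc (W.card : ℝ) ≤ V⁻¹ ^ 2 * (A ^ 2 * P * ((5 * T + 3 + 36 * P) * (1 + Real.log (2 * (P : ℝ))))) :=
          hMVT
      _ = ((A / V) ^ 2 * P * (5 * T + 3 + 36 * P)) * (1 + Real.log (2 * (P : ℝ))) := by ring
      _ ≤ (44 * (Qb ^ 2 * (2 ^ K * T ^ (κ + η)))) * ((K + 3) * l) :=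
          mul_le_mul hgeom hlogb hlog0 (by positivity)
      _ = 44 * (K + 3) * 2 ^ K * Q₁ ^ 2 * ((l ^ (2 * K) * l) * (T ^ (4 * η) * T ^ (κ + η))) := by
          rw [hQb2']; ring
      _ ≤ 44 * (K + 3) * 2 ^ K * Q₁ ^ 2 * (l ^ (4 * K + 1) * T ^ (κ + 10 * η)) := by gcongr
      _ ≤ (3 * 2 ^ K * C₁ * Q₁ ^ 4 + 44 * (K + 3) * 2 ^ K * Q₁ ^ 2) *
            (l ^ (4 * K + 1) * T ^ (κ + 10 * η)) :=
          mul_le_mul_of_nonneg_right (le_add_of_nonneg_left (by positivity)) (by positivity)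

/-! ## §6. The class (ii) zeros -/

/-- **The class (ii) bound made explicit** (the Type II zeros of Guth–Maynard §13, "the number of
Type II zeros is `≤ T^{2−2σ}(log T)^{O(1)}`", here by the fourth moment of `ζ` on disjoint windows
as in `HuxleyIvic.classTwo_fourth_le` with `Y = T^{1/2}`): with `A = 100 log T`, `T = 2U`,
`X ≤ 2T^η`, `W₀ = δ T^v/2²⁰` (`δ ≥ 1/5`) and `1 − 4v ≤ κ`, the bound of `classTwo_fourth_le` is at
most `K₂ (3/η)³ T^{κ+13η}`. (The variant of `HuxleyIvic.classTwo_numeric` for `δ = σ − 1/2 ≥ 1/5`.)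
[cite: GuthMaynard2026, Section 13, proof of Theorem 1.2] -/
theorem classTwo_numeric_gm {T U l A W₀ δ v κ η C₄ : ℝ} {X : ℕ} (hT : T = 2 * U) (hU1 : 1 ≤ U)
    (hl : l = Real.log T) (hl1 : 1 ≤ l) (hA : A = 100 * l) (hη : 0 < η) (hη1 : η ≤ 1)
    (hXpos : 0 < (X : ℝ)) (hXup : (X : ℝ) ≤ 2 * T ^ η)
    (hW₀ : W₀ = δ * T ^ v / 2 ^ 20) (hδ5 : 1 / 5 ≤ δ) (E3 : 1 - 4 * v ≤ κ) (hC40 : 0 ≤ C₄) :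
    2 * A * (C₄ * (3 * U) ^ (1 + η)) * ((2 * A * (X : ℝ) ^ 2) ^ 2 / W₀ ^ 4) ≤
      (200 * C₄ * 4 * 640000 * (625 * 2 ^ 80)) * ((3 : ℕ) / η) ^ 3 * T ^ (κ + 13 * η) := by
  have hT0 : 0 < T := by rw [hT]; linarith
  have hT1 : 1 ≤ T := by rw [hT]; linarith
  have hl0 : 0 < l := by linarith
  have hδ0 : 0 < δ := by linarith
  have hW₀0 : 0 < W₀ := by rw [hW₀]; positivity
  have h3U : (3 * U) ^ (1 + η) ≤ 4 * T ^ (1 + η) := by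
    calc (3 * U) ^ (1 + η) ≤ (2 * T) ^ (1 + η) :=
          Real.rpow_le_rpow (by positivity) (by rw [hT]; linarith) (by positivity)
      _ = (2 : ℝ) ^ (1 + η) * T ^ (1 + η) := Real.mul_rpow (by norm_num) hT0.le
      _ ≤ 4 * T ^ (1 + η) := by
          refine mul_le_mul_of_nonneg_right ?_ (by positivity)
          calc (2 : ℝ) ^ (1 + η) ≤ (2 : ℝ) ^ (2 : ℝ) :=
                Real.rpow_le_rpow_of_exponent_le (by norm_num) (by linarith)
            _ = 4 := by norm_num
  have hT2η : (T ^ η) ^ 2 = T ^ (2 * η) := by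
    rw [← Real.rpow_natCast (T ^ η), ← Real.rpow_mul hT0.le]; push_cast; ring_nf
  have hT4η : (T ^ (2 * η)) ^ 2 = T ^ (4 * η) := by
    rw [← Real.rpow_natCast (T ^ (2 * η)), ← Real.rpow_mul hT0.le]; push_cast; ring_nf
  have hX2 : (X : ℝ) ^ 2 ≤ 4 * T ^ (2 * η) := by
    calc (X : ℝ) ^ 2 ≤ (2 * T ^ η) ^ 2 := pow_le_pow_left₀ hXpos.le hXup 2
      _ = 4 * (T ^ η) ^ 2 := by ring
      _ = 4 * T ^ (2 * η) := by rw [hT2η]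
  have hnum : (2 * A * (X : ℝ) ^ 2) ^ 2 ≤ 640000 * l ^ 2 * T ^ (4 * η) := by
    have h1 : 2 * A * (X : ℝ) ^ 2 ≤ 2 * (100 * l) * (4 * T ^ (2 * η)) := by
      rw [hA]; exact mul_le_mul_of_nonneg_left hX2 (by positivity)
    calc (2 * A * (X : ℝ) ^ 2) ^ 2 ≤ (2 * (100 * l) * (4 * T ^ (2 * η))) ^ 2 :=
          pow_le_pow_left₀ (by rw [hA]; positivity) h1 2
      _ = 640000 * l ^ 2 * (T ^ (2 * η)) ^ 2 := by ring
      _ = 640000 * l ^ 2 * T ^ (4 * η) := by rw [hT4η]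
  have hT4v0 : 0 < T ^ (4 * v) := Real.rpow_pos_of_pos hT0 _
  have hW₀4 : T ^ (4 * v) / (625 * 2 ^ 80) ≤ W₀ ^ 4 := by
    have e : W₀ ^ 4 = δ ^ 4 * T ^ (4 * v) / 2 ^ 80 := by
      have h4 : (T ^ v) ^ 4 = T ^ (4 * v) := by
        rw [← Real.rpow_natCast (T ^ v), ← Real.rpow_mul hT0.le]; push_cast; ring_nf
      rw [hW₀, div_pow, mul_pow, h4]; norm_num
    rw [e, div_le_div_iff₀ (by positivity) (by positivity)]
    have hδ4' : (1 / 5 : ℝ) ^ 4 ≤ δ ^ 4 := pow_le_pow_left₀ (by norm_num) hδ5 4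
    have : T ^ (4 * v) * 2 ^ 80 ≤ (625 * δ ^ 4) * (T ^ (4 * v) * 2 ^ 80) := by
      refine le_mul_of_one_le_left (by positivity) ?_
      norm_num at hδ4' ⊢
      linarith
    linarith
  have hfrac : (2 * A * (X : ℝ) ^ 2) ^ 2 / W₀ ^ 4 ≤
      (640000 * l ^ 2 * T ^ (4 * η)) / (T ^ (4 * v) / (625 * 2 ^ 80)) :=
    div_le_div₀ (by positivity) hnum (by positivity) hW₀4
  have hexp : T ^ (1 + η) * T ^ (4 * η) / T ^ (4 * v) ≤ T ^ (κ + 5 * η) := by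
    rw [← Real.rpow_add hT0, ← Real.rpow_sub hT0]
    refine Real.rpow_le_rpow_of_exponent_le hT1 ?_
    linarith
  have hl3 : l ^ 3 ≤ ((3 : ℕ) / η) ^ 3 * T ^ η := by
    have := log_pow_le hT1 hη (p := 3) (by norm_num)
    rw [← hl] at this
    exact_mod_cast this
  have hTT : T ^ η * T ^ (κ + 5 * η) ≤ T ^ (κ + 13 * η) := by
    rw [← Real.rpow_add hT0]; exact Real.rpow_le_rpow_of_exponent_le hT1 (by linarith)
  have hA0 : 0 < A := by rw [hA]; positivity
  calc 2 * A * (C₄ * (3 * U) ^ (1 + η)) * ((2 * A * (X : ℝ) ^ 2) ^ 2 / W₀ ^ 4)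
      ≤ 2 * (100 * l) * (C₄ * (4 * T ^ (1 + η))) *
        ((640000 * l ^ 2 * T ^ (4 * η)) / (T ^ (4 * v) / (625 * 2 ^ 80))) := by
        rw [hA]; rw [hA] at hfrac; gcongr
    _ = (200 * C₄ * 4 * 640000 * (625 * 2 ^ 80)) * l ^ 3 * (T ^ (1 + η) * T ^ (4 * η) / T ^ (4 * v)) := by
        field_simp
        ring
    _ ≤ (200 * C₄ * 4 * 640000 * (625 * 2 ^ 80)) * l ^ 3 * T ^ (κ + 5 * η) := by gcongr
    _ ≤ (200 * C₄ * 4 * 640000 * (625 * 2 ^ 80)) * (((3 : ℕ) / η) ^ 3 * T ^ η) * T ^ (κ + 5 * η) := by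
        gcongr
    _ = (200 * C₄ * 4 * 640000 * (625 * 2 ^ 80)) * ((3 : ℕ) / η) ^ 3 * (T ^ η * T ^ (κ + 5 * η)) := by
        ring
    _ ≤ (200 * C₄ * 4 * 640000 * (625 * 2 ^ 80)) * ((3 : ℕ) / η) ^ 3 * T ^ (κ + 13 * η) := by gcongr

/-! ## §7. The count of a well-separated set of zeros in the window `7/10 ≤ σ ≤ 4/5` -/

set_option maxHeartbeats 1600000 in
/-- **The count of a well-separated set of zeros** (Guth–Maynard §13.1, proof of Theorem 1.2 on
the window `σ ∈ [7/10, 8/10]`, in the tree's zero-detection normalisation: `X = T^η`,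
`Y = T^{1/2}`, `T = 2U`; a Type I zero has a dyadic block `(M, 2M]`, `X ≤ M ≤ 100 log T · Y`,
whose `k`-th power (`T^{10/(6+10σ)} ≤ M^k ≤ 2^K T^{15/(6+10σ)+η}`, (13.1)) is large, and after
removing the real part (`taylor_pigeonhole`) its ordinate is counted on each sub-block by the
large values estimate (hypothesis `hLV`, Guth–Maynard Theorem 1.1, when the sub-block is
`≤ min(T, T^α)`) or by the mean value theorem; the Type II zeros are counted by the fourth moment
of `ζ` (`≤ T^{2−2σ+O(η)}`, and `2 − 2σ ≤ κ`)). For `7/10 ≤ σ ≤ 4/5` and `0 < η ≤ 1/100` there are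
`U₀, C` such that every finite set of zeros `ρ = β + iγ` of `ζ` with `β ≥ σ`, `U < γ ≤ 2U`
(`U ≥ U₀`), ordinates pairwise `≥ 300 log 2U` apart, has at most `C (2U)^{κ + 13η}` elements,
`κ = 15(1−σ)/(3+5σ)`. [cite: GuthMaynard2026, Section 13.1, proof of Theorem 1.2] -/
theorem card_sep_le_gm (h4 : zetaFourthMomentWeak)
    (hLV : ∀ ε : ℝ, 0 < ε → ∃ C T₀ : ℝ, ∀ T : ℝ, T₀ ≤ T →
      ∀ (N : ℕ) (b : ℕ → ℂ) (V : ℝ) (W : Finset ℝ), 1 ≤ N → (N : ℝ) ≤ T →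
      (∀ n, ‖b n‖ ≤ 1) → 0 < V → (∀ t ∈ W, 0 ≤ t ∧ t ≤ T) →
      (∀ t ∈ W, ∀ t' ∈ W, t ≠ t' → 1 ≤ |t - t'|) →
      (∀ t ∈ W, V ≤ ‖∑ n ∈ Finset.Icc N (2 * N), b n * (n : ℂ) ^ ((t : ℂ) * I)‖) →
      (W.card : ℝ) ≤ C * T ^ ε * ((N : ℝ) ^ 2 * V⁻¹ ^ 2 + (N : ℝ) ^ (18 / 5 : ℝ) * V⁻¹ ^ 4 +
        T * (N : ℝ) ^ (12 / 5 : ℝ) * V⁻¹ ^ 4))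
    {σ : ℝ} (hσ : 7 / 10 ≤ σ) (hσ1 : σ ≤ 4 / 5) {η : ℝ} (hη : 0 < η) (hη1 : η ≤ 1 / 100) :
    ∃ U₀ C : ℝ, 1 ≤ U₀ ∧ 0 ≤ C ∧ ∀ U : ℝ, U₀ ≤ U → ∀ Z : Finset ℂ,
      (∀ ρ ∈ Z, riemannZeta ρ = 0 ∧ σ ≤ ρ.re ∧ U < ρ.im ∧ ρ.im ≤ 2 * U) →
      (∀ ρ ∈ Z, ∀ ρ' ∈ Z, ρ ≠ ρ' → 3 * (100 * Real.log (2 * U)) ≤ |ρ.im - ρ'.im|) →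
      (Z.card : ℝ) ≤ C * (2 * U) ^ (15 * (1 - σ) / (3 + 5 * σ) + 13 * η) := by
  classical
  -- ### constants
  obtain ⟨C₄', hC4'⟩ := h4 η hη
  set C₄ : ℝ := max C₄' 0 with hC4def
  have hC40 : 0 ≤ C₄ := le_max_right _ _
  have hC4 : ∀ T : ℝ, 1 ≤ T → ∫ t in (0 : ℝ)..T, ‖riemannZeta (1 / 2 + t * I)‖ ^ 4 ≤ C₄ * T ^ (1 + η) :=
    fun T hT ↦ (hC4' T hT).trans (mul_le_mul_of_nonneg_right (le_max_left _ _) (by positivity))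
  obtain ⟨C_L, T₀, hCL⟩ := hLV η hη
  set C₁ : ℝ := max C_L 0 with hC₁def
  have hC₁0 : 0 ≤ C₁ := le_max_right _ _
  set K : ℕ := ⌈2 / η⌉₊ with hKdef
  have hK2 : 2 / η ≤ K := Nat.le_ceil _
  have h1η : (1 : ℝ) ≤ 1 / η := by rw [le_div_iff₀ hη]; nlinarith
  have h2η : (2 : ℝ) ≤ 2 / η := by rw [le_div_iff₀ hη]; nlinarith
  have hK1 : 1 ≤ K := by
    have : (1 : ℝ) ≤ K := le_trans (by linarith) hK2
    exact_mod_cast this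
  have hK0 : (0 : ℝ) < K := by exact_mod_cast hK1
  have hKη : 1 / η + 1 ≤ (K : ℝ) := by
    have : 2 / η = 1 / η + 1 / η := by ring
    linarith
  set θ : ℝ := η / (2 * K) with hθdef
  have hθ0 : 0 < θ := by positivity
  have hθK : 2 * K * θ = η := by rw [hθdef]; field_simp
  obtain ⟨C_d, hCd1, hCd⟩ := Literature.NumberTheory.Sieve.exists_card_divisors_le_mul_rpow' hθ0
  -- exponents
  obtain ⟨E1, -, -, E5, E32, ⟨hκ0, hκ1⟩, ⟨ha₁0, ha₁1⟩, ⟨ha₂0, ha₂1⟩, -, -⟩ := gm_exponents hσ hσ1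
  set κ : ℝ := 15 * (1 - σ) / (3 + 5 * σ) with hκ
  set a₁ : ℝ := 10 / (6 + 10 * σ) with ha₁
  set a₂ : ℝ := 15 / (6 + 10 * σ) with ha₂
  set α : ℝ := 15 * (1 - σ) / (3 + 5 * σ) / (18 / 5 - 4 * σ) with hα
  set δ : ℝ := σ - 1 / 2 with hδ
  set v : ℝ := 1 / 2 * δ with hv
  have hδ5 : 1 / 5 ≤ δ := by rw [hδ]; linarith
  have hδ0 : 0 < δ := by linarith
  have E3 : 1 - 4 * v ≤ κ := by rw [hv, hδ]; linarith
  set E : ℝ := (C_d ^ 2) ^ K with hEdef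
  have hE1 : 1 ≤ E := one_le_pow₀ (one_le_pow₀ hCd1)
  have hE0 : 0 < E := by linarith
  set Q₁ : ℝ := 4 * K * 51 ^ K * 2 ^ K * E with hQ₁
  set R₁ : ℝ := 3 * 2 ^ K * C₁ * Q₁ ^ 4 + 44 * (K + 3) * 2 ^ K * Q₁ ^ 2 with hR₁
  have hR₁0 : 0 ≤ R₁ := by rw [hR₁]; positivity
  set p : ℕ := 4 * K + 3 with hpdef
  have hp1 : 1 ≤ p := by omega
  set K₁ : ℝ := 17 * K * (2 * K + 9) * R₁ * ((p : ℝ) / η) ^ p with hK₁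
  have hK₁0 : 0 ≤ K₁ := by rw [hK₁]; positivity
  set K₂ : ℝ := 200 * C₄ * 4 * 640000 * (625 * 2 ^ 80) with hK₂
  set C : ℝ := K₁ + K₂ * ((3 : ℕ) / η) ^ 3 with hCdef
  have hC0 : 0 ≤ C := by positivity
  -- the threshold for the Taylor depth
  set Tn : ℝ := 8 * E * K * 204 ^ K with hTn
  -- ### thresholds
  obtain ⟨U₁, hU₁⟩ := Filter.eventually_atTop.1
    ((eventually_thresholds hη K 0 0).and
      ((eventually_ge_atTop T₀).and (eventually_ge_atTop Tn)))
  refine ⟨max U₁ 1, C, le_max_right _ _, hC0, fun U hU Z hZ hsep ↦ ?_⟩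
  obtain ⟨⟨hlT, hU38, h100l, hKlog2, -, -⟩, hUT₀, hUTn⟩ := hU₁ U (le_trans (le_max_left _ _) hU)
  have hU1 : 1 ≤ U := le_trans (by norm_num) hU38
  set T : ℝ := 2 * U with hT
  set l : ℝ := Real.log T with hl
  set A : ℝ := 100 * l with hA
  have hT1 : 1 ≤ T := by rw [hT]; linarith
  have hT0 : 0 < T := by linarith
  have hT4 : (10 : ℝ) ^ 4 ≤ T := by rw [hT]; linarith
  have hUT : U ≤ T := by rw [hT]; linarith
  have hTT₀ : T₀ ≤ T := hUT₀.trans hUT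
  have hTTn : Tn ≤ T := hUTn.trans hUT
  have hl1 : 1 ≤ l := by
    rw [hl, Real.le_log_iff_exp_le (by linarith)]; linarith [Real.exp_one_lt_d9]
  have hl0 : 0 < l := by linarith
  have hA0 : 0 < A := by positivity
  have hAU : A ≤ U := by rw [hA]; linarith
  have hTδ : 2 ^ 36 / (σ - 1 / 2) + 3 ≤ T := by
    rw [← hδ]
    have : 2 ^ 36 / δ ≤ 2 ^ 36 / (1 / 5) := div_le_div_of_nonneg_left (by norm_num) (by norm_num) hδ5
    rw [hT]; linarith
  have hTpow : ∀ e : ℝ, T ^ e = Real.exp (e * l) := fun e ↦ by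
    rw [hl, Real.rpow_def_of_pos hT0]; ring_nf
  have hlT : l ≤ T := by
    rw [hl]; exact (Real.log_le_sub_one_of_pos hT0).trans (by linarith)
  -- the large values estimate at this `T`
  have hLVT : ∀ (N : ℕ) (b : ℕ → ℂ) (V : ℝ) (W : Finset ℝ), 1 ≤ N → (N : ℝ) ≤ T →
      (∀ n, ‖b n‖ ≤ 1) → 0 < V → (∀ t ∈ W, 0 ≤ t ∧ t ≤ T) →
      (∀ t ∈ W, ∀ t' ∈ W, t ≠ t' → 1 ≤ |t - t'|) →
      (∀ t ∈ W, V ≤ ‖∑ n ∈ Finset.Icc N (2 * N), b n * (n : ℂ) ^ ((t : ℂ) * I)‖) →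
      (W.card : ℝ) ≤ C₁ * T ^ η * ((N : ℝ) ^ 2 * V⁻¹ ^ 2 + (N : ℝ) ^ (18 / 5 : ℝ) * V⁻¹ ^ 4 +
        T * (N : ℝ) ^ (12 / 5 : ℝ) * V⁻¹ ^ 4) := by
    intro N b V W hN hNT hb hV hW hWsep hWlarge
    refine (hCL T hTT₀ N b V W hN hNT hb hV hW hWsep hWlarge).trans ?_
    exact mul_le_mul_of_nonneg_right (mul_le_mul_of_nonneg_right (le_max_left _ _) (by positivity))
      (by positivity)
  -- `X`
  set X : ℕ := ⌈T ^ η⌉₊ with hXdef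
  have hTη1 : 1 ≤ T ^ η := Real.one_le_rpow hT1 hη.le
  have hTη0 : 0 < T ^ η := by positivity
  have hXlow : T ^ η ≤ X := Nat.le_ceil _
  have hXup : (X : ℝ) ≤ 2 * T ^ η := by
    have := (Nat.ceil_lt_add_one hTη0.le).le
    rw [← hXdef] at this; linarith
  have hX1 : 1 ≤ X := by
    have : (1 : ℝ) ≤ X := hTη1.trans hXlow
    exact_mod_cast this
  have hXpos : (0 : ℝ) < X := by exact_mod_cast hX1
  have hTηT : T ^ η ≤ T := Real.rpow_le_self_of_one_le hT1 (by linarith)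
  have hXT2 : (X : ℝ) ≤ T ^ 2 := by nlinarith
  -- `Y = T^{1/2}`
  set Y : ℝ := T ^ (1 / 2 : ℝ) with hYdef
  have hY0 : 0 < Y := by positivity
  have hY10 : 10 ≤ Y := by
    calc (10 : ℝ) ≤ T ^ (1 / 4 : ℝ) := ten_le_rpow_quarter hT4
      _ ≤ T ^ (1 / 2 : ℝ) := Real.rpow_le_rpow_of_exponent_le hT1 (by norm_num)
  have hY1 : 1 ≤ Y := by linarith
  have hYT2 : Y ≤ T ^ 2 := by
    calc Y ≤ T ^ (2 : ℝ) := Real.rpow_le_rpow_of_exponent_le hT1 (by norm_num)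
      _ = T ^ 2 := by norm_cast
  have hYpow : ∀ e : ℝ, Y ^ e = T ^ (1 / 2 * e) := fun e ↦ by rw [hYdef, ← Real.rpow_mul hT0.le]
  -- `N₀`, `J`
  set N₀ : ℕ := ⌊100 * l * Y⌋₊ with hN₀
  have hN₀le : (N₀ : ℝ) ≤ 100 * l * Y := Nat.floor_le (by positivity)
  set J : ℕ := Nat.log 2 N₀ + 1 with hJdef
  have hJ : N₀ < 2 ^ J := Nat.lt_pow_succ_log_self (by norm_num) N₀
  have hJ1 : 1 ≤ J := by rw [hJdef]; omega
  have hJ17 : (J : ℝ) ≤ 17 * l := by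
    have h1 : (J : ℝ) = Nat.log 2 N₀ + 1 := by rw [hJdef]; push_cast; ring
    rw [h1]
    rcases Nat.eq_zero_or_pos N₀ with hN | hN
    · rw [hN]; simp; linarith
    · have hN₀1 : 1 ≤ N₀ := hN
      have hN₀pos : (0 : ℝ) < N₀ := by exact_mod_cast hN₀1
      have hlogN₀ : Real.log N₀ ≤ 8 * l := by
        have h1 : (N₀ : ℝ) ≤ 100 * l * T ^ 2 := hN₀le.trans (by gcongr)
        have h2 : Real.log N₀ ≤ Real.log (100 * l * T ^ 2) := Real.log_le_log hN₀pos h1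
        have h3 : Real.log (100 * l * T ^ 2) = Real.log 100 + Real.log l + 2 * Real.log T := by
          rw [Real.log_mul (by positivity) (by positivity), Real.log_mul (by norm_num) (by positivity),
            Real.log_pow]; push_cast; ring
        have h4 : Real.log l ≤ l := (Real.log_le_sub_one_of_pos hl0).trans (by linarith)
        rw [h3, ← hl] at h2
        linarith [HuxleyZeroDensity.log_hundred_le]
      have h2 := HuxleyZeroDensity.natLog_two_le N₀ hN₀1
      linarith
  have hJ1r : (1 : ℝ) ≤ J := by exact_mod_cast hJ1
  have hJ0 : (0 : ℝ) < J := by linarith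
  -- `Y₁`, `Y₂`, `W₀`
  set Y₁ : ℝ := T ^ a₁ with hY₁def
  set Y₂ : ℝ := 2 ^ K * T ^ (a₂ + η) with hY₂def
  have hY₁1 : 1 ≤ Y₁ := Real.one_le_rpow hT1 (by linarith)
  have h2K1 : (1 : ℝ) ≤ 2 ^ K := one_le_pow₀ (by norm_num)
  have hT2y1 : 1 ≤ T ^ (a₂ + η) := Real.one_le_rpow hT1 (by linarith)
  have hY₂1 : 1 ≤ Y₂ := one_le_mul_of_one_le_of_one_le h2K1 hT2y1
  have hY₂0 : 0 < Y₂ := by linarith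
  set W₀ : ℝ := δ * Y ^ δ / 2 ^ 20 with hW₀
  have hW₀0 : 0 < W₀ := by positivity
  have hYδ : Y ^ δ = T ^ v := by rw [hYpow, hv]
  -- the zero-detecting coefficients
  set c : ℕ → ℂ := smoothed (mollCoeff X) Y with hc
  have hcd : ∀ n, ‖c n‖ ≤ (n.divisors.card : ℝ) := fun n ↦
    (norm_smoothed_le _ hY0 n).trans (norm_mollCoeff_le X n)
  -- facts about the zeros
  have hre : ∀ ρ ∈ Z, σ ≤ ρ.re ∧ ρ.re ≤ 1 := fun ρ hρ ↦
    ⟨(hZ ρ hρ).2.1, (LFunctions.re_lt_one_of_riemannZeta_eq_zero (hZ ρ hρ).1).le⟩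
  have him : ∀ ρ ∈ Z, 0 ≤ ρ.im ∧ ρ.im ≤ T := by
    intro ρ hρ
    have h1 := (hZ ρ hρ).2.2
    rw [hT]; constructor <;> linarith [h1.1, h1.2]
  have hsep1 : ∀ ρ ∈ Z, ∀ ρ' ∈ Z, ρ ≠ ρ' → 1 ≤ |ρ.im - ρ'.im| := by
    intro ρ hρ ρ' hρ' hne
    have := hsep ρ hρ ρ' hρ' hne
    linarith only [this, hA0, hl1, hA]
  -- ### the two classes
  set ZI := Z.filter (fun ρ ↦ 1 / 3 < ‖∑ n ∈ Finset.Ioc X N₀, c n * (n : ℂ) ^ (-ρ)‖) with hZI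
  set ZII := Z.filter (fun ρ ↦ W₀ ≤ ∫ y in (-A)..A,
      ‖riemannZeta (1 / 2 + ((ρ.im + y : ℝ) : ℂ) * I) * mollifier X (1 / 2 + ((ρ.im + y : ℝ) : ℂ) * I)‖)
    with hZII
  have hcover : Z ⊆ ZI ∪ ZII := by
    intro ρ hρ
    obtain ⟨hζ, hβ, hγ1, hγ2⟩ := hZ ρ hρ
    have hγ : 100 * Real.log T ≤ |ρ.im| := by
      rw [abs_of_pos (by linarith)]; rw [← hl]; linarith
    have hγT : |ρ.im| ≤ T := by rw [abs_of_pos (by linarith)]; linarith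
    have hdich := HuxleyZeroDensity.zeroDetection_integral hδ0 hTδ hX1 hXT2 hY10 hYT2 hζ
      (by rw [hδ]; linarith) hγ hγT
    rw [Finset.mem_union, hZI, hZII, Finset.mem_filter, Finset.mem_filter]
    rcases hdich with h1 | h2
    · exact Or.inl ⟨hρ, h1⟩
    · right
      have h2' := h2
      rw [← hl, ← hA] at h2'
      have hW₀le : W₀ ≤ δ * Y ^ (ρ.re - 1 / 2) / 2 ^ 20 := by
        rw [hW₀]
        have : Y ^ δ ≤ Y ^ (ρ.re - 1 / 2) :=
          Real.rpow_le_rpow_of_exponent_le hY1 (by rw [hδ]; linarith)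
        gcongr
      exact ⟨hρ, hW₀le.trans h2'⟩
  -- ### class (i): the power `k`
  have hkex : ∀ M : ℕ, X ≤ M → M < N₀ →
      ∃ k : ℕ, 1 ≤ k ∧ k ≤ K ∧ Y₁ ≤ (M : ℝ) ^ k ∧ (2 * (M : ℝ)) ^ k ≤ Y₂ := by
    intro M hXM hMN
    have hM1 : (1 : ℝ) ≤ M := by exact_mod_cast hX1.trans hXM
    have hM0 : (0 : ℝ) < M := by linarith
    set m : ℝ := Real.log M with hm
    have hMexp : (M : ℝ) = Real.exp m := by rw [hm, Real.exp_log hM0]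
    have hmlow : η * l ≤ m := by
      have h1 : T ^ η ≤ M := hXlow.trans (by exact_mod_cast hXM)
      have h2 : Real.log (T ^ η) ≤ m := Real.log_le_log hTη0 h1
      rwa [Real.log_rpow hT0, ← hl] at h2
    have hmup : 2 * m ≤ (1 + η) * l := by
      have h1 : (M : ℝ) ≤ 100 * l * Y := le_trans (by exact_mod_cast hMN.le) hN₀le
      have h2 : 100 * l * Y ≤ T ^ (η / 2) * Y := by
        have h100l' : 100 * l ≤ T ^ (η / 2) := by rw [hA] at h100l; exact h100l
        exact mul_le_mul_of_nonneg_right h100l' hY0.le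
      have h3 : T ^ (η / 2) * Y = T ^ (1 / 2 + η / 2) := by
        rw [hYdef, ← Real.rpow_add hT0]; ring_nf
      have h4 : m ≤ (1 / 2 + η / 2) * l := by
        have := Real.log_le_log hM0 ((h1.trans h2).trans h3.le)
        rwa [Real.log_rpow hT0, ← hl, ← hm] at this
      linarith
    obtain ⟨k, hk1, hkK, hkm1, hkm2⟩ := exists_power_gm (a₁ := a₁) (a₂ := a₂) hη hl0 hmlow hmup
      (by linarith only [ha₁0]) (by linarith only [ha₁1]) ha₂0.le (by linarith only [E32]) hKη
    have hMk : (M : ℝ) ^ k = Real.exp (k * m) := by rw [hMexp, ← Real.exp_nat_mul]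
    refine ⟨k, hk1, hkK, ?_, ?_⟩
    · rw [hMk, hY₁def, hTpow, Real.exp_le_exp]
      exact hkm1
    · rw [mul_pow, hMk, hY₂def, hTpow]
      exact mul_le_mul (pow_le_pow_right₀ (by norm_num) hkK) (Real.exp_le_exp.2 hkm2)
        (by positivity) (by positivity)
  -- ### class (i): the Taylor depth `n`
  set n : ℕ := ⌈(K + 4) * l / Real.log 2⌉₊ with hndef
  have hlog2 : 0 < Real.log 2 := Real.log_pos (by norm_num)
  have hlog2' : 1 / 2 < Real.log 2 := by have := Real.log_two_gt_d9; linarith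
  have hnlow : (K + 4) * l / Real.log 2 ≤ n := Nat.le_ceil _
  have hnq0 : 0 < (K + 4) * l / Real.log 2 := by positivity
  have hn1 : 1 ≤ n := by
    have : (0 : ℝ) < n := lt_of_lt_of_le hnq0 hnlow
    exact_mod_cast this
  have hnup : (n : ℝ) ≤ (2 * K + 9) * l := by
    have h1 : (n : ℝ) < (K + 4) * l / Real.log 2 + 1 := Nat.ceil_lt_add_one hnq0.le
    have h2 : (K + 4) * l / Real.log 2 ≤ 2 * ((K + 4) * l) := by
      rw [div_le_iff₀ hlog2]
      have h0 : 0 ≤ ((K : ℝ) + 4) * l := by positivity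
      have h3 : (1 : ℝ) ≤ 2 * Real.log 2 := by linarith only [hlog2']
      calc ((K : ℝ) + 4) * l = ((K + 4) * l) * 1 := by ring
        _ ≤ ((K + 4) * l) * (2 * Real.log 2) := mul_le_mul_of_nonneg_left h3 h0
        _ = 2 * ((K + 4) * l) * Real.log 2 := by ring
    have h4 : (0 : ℝ) ≤ K * l := by positivity
    linarith only [h1, h2, hl1, h4]
  have h2n : 8 * (E * Y₂ ^ η * Y₂) * (K * (3 * (J : ℝ)) ^ K) ≤ 2 ^ n := by
    -- `2^n ≥ T^{K+4}`
    have h1 : T ^ ((K : ℝ) + 4) ≤ 2 ^ n := by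
      rw [hTpow]
      have e : (2 : ℝ) ^ n = Real.exp (n * Real.log 2) := by
        rw [← Real.rpow_natCast, Real.rpow_def_of_pos (by norm_num)]; ring_nf
      rw [e, Real.exp_le_exp]
      rw [div_le_iff₀ hlog2] at hnlow
      exact hnlow
    refine le_trans ?_ h1
    -- `Y₂^η Y₂ ≤ 4^K T²`, `(3J)^K ≤ 51^K T^K`
    have hY₂η : Y₂ ^ η ≤ 2 ^ K * T ^ (2 * η) := by
      rw [hY₂def, Real.mul_rpow (by positivity) (by positivity), ← Real.rpow_mul hT0.le]
      refine mul_le_mul ?_ (Real.rpow_le_rpow_of_exponent_le hT1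
        (mul_le_mul_of_nonneg_right (by linarith only [ha₂1, hη1]) hη.le)) (by positivity)
        (by positivity)
      calc ((2 : ℝ) ^ K) ^ η ≤ ((2 : ℝ) ^ K) ^ (1 : ℝ) :=
            Real.rpow_le_rpow_of_exponent_le h2K1 (by linarith)
        _ = 2 ^ K := Real.rpow_one _
    have hY₂2 : Y₂ ^ η * Y₂ ≤ 4 ^ K * T ^ (2 : ℝ) := by
      calc Y₂ ^ η * Y₂ ≤ (2 ^ K * T ^ (2 * η)) * (2 ^ K * T ^ (a₂ + η)) :=
            mul_le_mul_of_nonneg_right hY₂η hY₂0.le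
        _ = (2 ^ K * 2 ^ K) * (T ^ (2 * η) * T ^ (a₂ + η)) := by ring
        _ = 4 ^ K * T ^ (2 * η + (a₂ + η)) := by
            rw [← mul_pow, ← Real.rpow_add hT0]; norm_num
        _ ≤ 4 ^ K * T ^ (2 : ℝ) :=
            mul_le_mul_of_nonneg_left (Real.rpow_le_rpow_of_exponent_le hT1 (by linarith))
              (by positivity)
    have hJK : (3 * (J : ℝ)) ^ K ≤ 51 ^ K * T ^ (K : ℝ) := by
      rw [Real.rpow_natCast, ← mul_pow]
      refine pow_le_pow_left₀ (by positivity) ?_ K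
      linarith only [hJ17, hlT]
    have hTK : T ^ (2 : ℝ) * T ^ (K : ℝ) * T = T ^ ((K : ℝ) + 3) := by
      rw [← Real.rpow_add hT0, mul_comm, ← Real.rpow_one_add' hT0.le (by positivity)]; ring_nf
    calc 8 * (E * Y₂ ^ η * Y₂) * (K * (3 * (J : ℝ)) ^ K)
        = 8 * E * K * ((Y₂ ^ η * Y₂) * (3 * (J : ℝ)) ^ K) := by ring
      _ ≤ 8 * E * K * ((4 ^ K * T ^ (2 : ℝ)) * (51 ^ K * T ^ (K : ℝ))) := by gcongr
      _ = Tn * (T ^ (2 : ℝ) * T ^ (K : ℝ)) := by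
          rw [hTn, show (204 : ℝ) ^ K = 4 ^ K * 51 ^ K by rw [← mul_pow]; norm_num]; ring
      _ ≤ T * (T ^ (2 : ℝ) * T ^ (K : ℝ)) := mul_le_mul_of_nonneg_right hTTn (by positivity)
      _ = T ^ ((K : ℝ) + 3) := by rw [← hTK]; ring
      _ ≤ T ^ ((K : ℝ) + 4) := Real.rpow_le_rpow_of_exponent_le hT1 (by linarith)
  -- ### class (i): the count
  set R₀ : ℝ := R₁ * (l ^ (4 * K + 1) * T ^ (κ + 10 * η)) with hR₀
  have hR₀0 : 0 ≤ R₀ := by rw [hR₀]; positivity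
  have hblk : ∀ (P : ℕ) (a : ℕ → ℂ) (V : ℝ) (W : Finset ℝ), 1 ≤ P → Y₁ ≤ (P : ℝ) →
      2 * (P : ℝ) ≤ Y₂ →
      (∀ r ∈ Finset.Ioc P (2 * P), ‖a r‖ ≤ ((C_d ^ 2) ^ K) * Y₂ ^ η * (P : ℝ) ^ (-σ)) →
      (1 / (3 * (J : ℝ))) ^ K / K / 4 ≤ V →
      (∀ t ∈ W, 0 ≤ t ∧ t ≤ T) → (∀ t ∈ W, ∀ t' ∈ W, t ≠ t' → 1 ≤ |t - t'|) →
      (∀ t ∈ W, V ≤ ‖∑ r ∈ Finset.Ioc P (2 * P), a r * (r : ℂ) ^ (-((t : ℂ) * I))‖) →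
      (W.card : ℝ) ≤ R₀ := by
    intro P a V W hP hY₁P h2P ha hV hW hWsep hWlarge
    have := block_count_gm (K := K) (J := J) hT1 hl hl1 hη hη1 hσ hσ1 hκ hα hC₁0 hE1 hK1 hJ1 hJ17
      hY₁def hY₂def hLVT hP hY₁P h2P ha hV hW hWsep hWlarge
    rw [hR₀, hR₁, hQ₁]; exact this
  have hI := classOne_card_le_gm hθ0.le hη.le hCd1 hCd hK1 hθK.le hcd (by linarith) hX1 hJ hY₁1
    hkex hn1 h2n hR₀0 hblk Z hre him hsep1
  rw [← hZI] at hI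
  -- ### bounding the class (i) expression
  have hlp : l ^ p ≤ ((p : ℝ) / η) ^ p * T ^ η := log_pow_le hT1 hη hp1
  have hIfin : (ZI.card : ℝ) ≤ K₁ * T ^ (κ + 13 * η) := by
    have h1 : (J : ℝ) * (K * (n * R₀)) ≤ (17 * l) * (K * (((2 * K + 9) * l) * R₀)) := by gcongr
    have e1 : (17 * l) * (K * (((2 * K + 9) * l) * R₀)) =
        17 * K * (2 * K + 9) * R₁ * (l ^ p * T ^ (κ + 10 * η)) := by
      rw [hR₀, hpdef]; ring
    have hTT : T ^ η * T ^ (κ + 10 * η) ≤ T ^ (κ + 13 * η) := by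
      rw [← Real.rpow_add hT0]; exact Real.rpow_le_rpow_of_exponent_le hT1 (by linarith)
    calc (ZI.card : ℝ) ≤ _ := hI
      _ ≤ _ := h1
      _ = 17 * K * (2 * K + 9) * R₁ * (l ^ p * T ^ (κ + 10 * η)) := e1
      _ ≤ 17 * K * (2 * K + 9) * R₁ * ((((p : ℝ) / η) ^ p * T ^ η) * T ^ (κ + 10 * η)) := by gcongr
      _ = K₁ * (T ^ η * T ^ (κ + 10 * η)) := by rw [hK₁]; ring
      _ ≤ K₁ * T ^ (κ + 13 * η) := mul_le_mul_of_nonneg_left hTT hK₁0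
  -- ### class (ii)
  have hZII_Z : ∀ ρ ∈ ZII, U < ρ.im ∧ ρ.im ≤ 2 * U := fun ρ hρ ↦ by
    rw [hZII, Finset.mem_filter] at hρ; exact (hZ ρ hρ.1).2.2
  have hsepII : ∀ ρ ∈ ZII, ∀ ρ' ∈ ZII, ρ ≠ ρ' → 2 * A ≤ |ρ.im - ρ'.im| := by
    intro ρ hρ ρ' hρ' hne
    rw [hZII, Finset.mem_filter] at hρ hρ'
    have := hsep ρ hρ.1 ρ' hρ'.1 hne; linarith
  have hlargeII : ∀ ρ ∈ ZII, W₀ ≤ ∫ y in (-A)..A,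
      ‖riemannZeta (1 / 2 + ((ρ.im + y : ℝ) : ℂ) * I) * mollifier X (1 / 2 + ((ρ.im + y : ℝ) : ℂ) * I)‖ :=
    fun ρ hρ ↦ by rw [hZII, Finset.mem_filter] at hρ; exact hρ.2
  have hW₀' : W₀ = δ * T ^ v / 2 ^ 20 := by rw [hW₀, hYδ]
  have hIIfin : (ZII.card : ℝ) ≤ K₂ * ((3 : ℕ) / η) ^ 3 * T ^ (κ + 13 * η) := by
    have hII := classTwo_fourth_le hU1 hA0 hAU hW₀0 hX1 ZII hZII_Z hsepII hlargeII hC4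
    exact hII.trans (classTwo_numeric_gm hT hU1 hl hl1 hA hη (by linarith) hXpos hXup hW₀' hδ5 E3 hC40)
  -- ### total
  have htot : (Z.card : ℝ) ≤ ZI.card + ZII.card := by
    exact_mod_cast (Finset.card_le_card hcover).trans (Finset.card_union_le _ _)
  calc (Z.card : ℝ) ≤ ZI.card + ZII.card := htot
    _ ≤ K₁ * T ^ (κ + 13 * η) + K₂ * ((3 : ℕ) / η) ^ 3 * T ^ (κ + 13 * η) :=
        add_le_add hIfin hIIfin
    _ = C * T ^ (κ + 13 * η) := by rw [hCdef]; ring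

/-! ## §8. Thinning, the window estimate, and the glue -/

/-- **The well-spaced count** (representatives `≥ 1` apart, thinned by `⌊γ⌋ mod k`,
`k = ⌈300 log 2U⌉ + 1`, `HuxleyZeroDensity.card_le_of_thinning`; then `card_sep_le_gm` on each
class and `log 2U ≤ η⁻¹(2U)^η`): for `7/10 ≤ σ ≤ 4/5` and `0 < η ≤ 1/100` there are `U₀, C` with
`#Z ≤ C U^{κ + 14η}` for every finite set `Z` of zeros `β + iγ` of `ζ`, `β ≥ σ`, `U < γ ≤ 2U`
(`U ≥ U₀`), ordinates pairwise `≥ 1` apart. [cite: GuthMaynard2026, Section 13.1, proof of Theorem 1.2] -/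
theorem wellSpaced_gm (h4 : zetaFourthMomentWeak)
    (hLV : ∀ ε : ℝ, 0 < ε → ∃ C T₀ : ℝ, ∀ T : ℝ, T₀ ≤ T →
      ∀ (N : ℕ) (b : ℕ → ℂ) (V : ℝ) (W : Finset ℝ), 1 ≤ N → (N : ℝ) ≤ T →
      (∀ n, ‖b n‖ ≤ 1) → 0 < V → (∀ t ∈ W, 0 ≤ t ∧ t ≤ T) →
      (∀ t ∈ W, ∀ t' ∈ W, t ≠ t' → 1 ≤ |t - t'|) →
      (∀ t ∈ W, V ≤ ‖∑ n ∈ Finset.Icc N (2 * N), b n * (n : ℂ) ^ ((t : ℂ) * I)‖) →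
      (W.card : ℝ) ≤ C * T ^ ε * ((N : ℝ) ^ 2 * V⁻¹ ^ 2 + (N : ℝ) ^ (18 / 5 : ℝ) * V⁻¹ ^ 4 +
        T * (N : ℝ) ^ (12 / 5 : ℝ) * V⁻¹ ^ 4))
    {σ : ℝ} (hσ : 7 / 10 ≤ σ) (hσ1 : σ ≤ 4 / 5) {η : ℝ} (hη : 0 < η) (hη1 : η ≤ 1 / 100) :
    ∃ U₀ C : ℝ, 1 ≤ U₀ ∧ 0 ≤ C ∧ ∀ U : ℝ, U₀ ≤ U → ∀ Z : Finset ℂ,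
      (∀ ρ ∈ Z, riemannZeta ρ = 0 ∧ σ ≤ ρ.re ∧ U < ρ.im ∧ ρ.im ≤ 2 * U) →
      (∀ ρ ∈ Z, ∀ ρ' ∈ Z, ρ ≠ ρ' → 1 ≤ |ρ.im - ρ'.im|) →
      (Z.card : ℝ) ≤ C * U ^ (15 * (1 - σ) / (3 + 5 * σ) + 14 * η) := by
  classical
  obtain ⟨U₀, C, hU₀, hC0, hbd⟩ := card_sep_le_gm h4 hLV hσ hσ1 hη hη1
  set κ : ℝ := 15 * (1 - σ) / (3 + 5 * σ) with hκ
  obtain ⟨-, -, -, -, -, ⟨hk1, hk2⟩, -⟩ := gm_exponents hσ hσ1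
  refine ⟨U₀, 302 * C * (2 / η) * 4, hU₀, by positivity, fun U hU Z hZ hsep ↦ ?_⟩
  have hU1 : 1 ≤ U := hU₀.trans hU
  set T : ℝ := 2 * U with hT
  have hT2 : 2 ≤ T := by rw [hT]; linarith
  have hT0 : 0 < T := by linarith
  have hT1 : 1 ≤ T := by linarith
  set l : ℝ := Real.log T with hl
  have hl0 : 0 ≤ l := Real.log_nonneg hT1
  set A : ℝ := 100 * l with hA
  set k : ℕ := ⌈3 * A⌉₊ + 1 with hk
  have hk1' : 1 ≤ k := by rw [hk]; omega
  have hkA : 3 * A ≤ (k : ℝ) - 1 := by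
    rw [hk]; push_cast
    have := Nat.le_ceil (3 * A)
    linarith
  have hkle : (k : ℝ) ≤ 302 * l + 2 := by
    rw [hk]; push_cast
    have := (Nat.ceil_lt_add_one (by positivity : (0 : ℝ) ≤ 3 * A)).le
    rw [hA] at this; linarith
  -- thinning
  have hpos : ∀ ρ ∈ Z, 0 ≤ ρ.im := fun ρ hρ ↦ by linarith [(hZ ρ hρ).2.2.1]
  have hB : ∀ Z' ⊆ Z, (∀ ρ ∈ Z', ∀ ρ' ∈ Z', ρ ≠ ρ' → (k : ℝ) - 1 ≤ |ρ.im - ρ'.im|) →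
      (Z'.card : ℝ) ≤ C * T ^ (κ + 13 * η) := by
    intro Z' hZ' hsep'
    refine hbd U hU Z' (fun ρ hρ ↦ hZ ρ (hZ' hρ)) fun ρ hρ ρ' hρ' hne ↦ ?_
    rw [← hT, ← hl, ← hA]
    exact hkA.trans (hsep' ρ hρ ρ' hρ' hne)
  have hthin := HuxleyZeroDensity.card_le_of_thinning Z hk1' hpos hsep hB
  -- `l + 1 ≤ (2/η) T^η`
  have hlog : l ≤ T ^ η / η := Real.log_le_rpow_div hT0.le hη
  have hTη1 : 1 ≤ T ^ η := Real.one_le_rpow hT1 hη.le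
  have h1η : (1 : ℝ) ≤ 1 / η := by rw [le_div_iff₀ hη]; linarith
  have hl1' : l + 1 ≤ 2 / η * T ^ η := by
    have e : T ^ η / η = 1 / η * T ^ η := by ring
    rw [e] at hlog
    have : (1 : ℝ) ≤ 1 / η * T ^ η := one_le_mul_of_one_le_of_one_le h1η hTη1
    have e2 : 2 / η * T ^ η = 2 * (1 / η * T ^ η) := by ring
    rw [e2]; linarith
  -- `T^{κ+14η} ≤ 4 U^{κ+14η}`
  have hTU : T ^ (κ + 14 * η) ≤ 4 * U ^ (κ + 14 * η) := by
    rw [hT, Real.mul_rpow (by norm_num) (by linarith)]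
    refine mul_le_mul_of_nonneg_right ?_ (by positivity)
    calc (2 : ℝ) ^ (κ + 14 * η) ≤ (2 : ℝ) ^ (2 : ℝ) :=
          Real.rpow_le_rpow_of_exponent_le (by norm_num) (by linarith)
      _ = 4 := by norm_num
  have hTT : T ^ η * T ^ (κ + 13 * η) = T ^ (κ + 14 * η) := by
    rw [← Real.rpow_add hT0]; congr 1; ring
  have hk302 : (k : ℝ) ≤ 302 * (l + 1) := by linarith
  calc (Z.card : ℝ) ≤ k * (C * T ^ (κ + 13 * η)) := hthin
    _ ≤ (302 * (l + 1)) * (C * T ^ (κ + 13 * η)) :=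
        mul_le_mul_of_nonneg_right hk302 (by positivity)
    _ = 302 * C * (l + 1) * T ^ (κ + 13 * η) := by ring
    _ ≤ 302 * C * (2 / η * T ^ η) * T ^ (κ + 13 * η) := by gcongr
    _ = 302 * C * (2 / η) * (T ^ η * T ^ (κ + 13 * η)) := by ring
    _ = 302 * C * (2 / η) * T ^ (κ + 14 * η) := by rw [hTT]
    _ ≤ 302 * C * (2 / η) * (4 * U ^ (κ + 14 * η)) := by gcongr
    _ = 302 * C * (2 / η) * 4 * U ^ (κ + 14 * η) := by ring

end GuthMaynardWindow

/-- **Guth–Maynard's Theorem 1.2 on the window `7/10 ≤ σ ≤ 4/5`, from the large values estimate.**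
If the large values estimate of Guth–Maynard's Theorem 1.1 holds — for every `ε > 0` there are
`C, T₀` such that for `T ≥ T₀`, `1 ≤ N ≤ T`, `|b_n| ≤ 1`, and a `1`-separated set `W ⊂ [0, T]`
with `|∑_{n=N}^{2N} b_n n^{it}| ≥ V > 0` on `W`, one has
`#W ≤ C T^ε (N²V⁻² + N^{18/5}V⁻⁴ + TN^{12/5}V⁻⁴)` — then `N(σ, T) ≪_ε T^{15(1−σ)/(3+5σ)+ε}` for
every `7/10 ≤ σ ≤ 4/5` (§13.1 of the paper: zero detection, the power `k` of (13.1), Theorem 1.1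
or the mean value theorem on `D̃^k`, and the Type II zeros; here over the tree's zero-detection
method, the fourth moment of `ζ` for the Type II zeros, Jensen windows and dyadic summation).
[cite: GuthMaynard2026, Theorem 1.2 and Section 13.1] -/
theorem isBigO_zetaZeroCountRe_window_of_largeValues
    (hLV : ∀ ε : ℝ, 0 < ε → ∃ C T₀ : ℝ, ∀ T : ℝ, T₀ ≤ T →
      ∀ (N : ℕ) (b : ℕ → ℂ) (V : ℝ) (W : Finset ℝ), 1 ≤ N → (N : ℝ) ≤ T →
      (∀ n, ‖b n‖ ≤ 1) → 0 < V → (∀ t ∈ W, 0 ≤ t ∧ t ≤ T) →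
      (∀ t ∈ W, ∀ t' ∈ W, t ≠ t' → 1 ≤ |t - t'|) →
      (∀ t ∈ W, V ≤ ‖∑ n ∈ Finset.Icc N (2 * N), b n * (n : ℂ) ^ ((t : ℂ) * I)‖) →
      (W.card : ℝ) ≤ C * T ^ ε * ((N : ℝ) ^ 2 * V⁻¹ ^ 2 + (N : ℝ) ^ (18 / 5 : ℝ) * V⁻¹ ^ 4 +
        T * (N : ℝ) ^ (12 / 5 : ℝ) * V⁻¹ ^ 4))
    {ε σ : ℝ} (hε : 0 < ε) (hσ : 7 / 10 ≤ σ) (hσ1 : σ ≤ 4 / 5) :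
    (fun T : ℝ ↦ (zetaZeroCountRe σ T : ℝ)) =O[atTop]
      fun T : ℝ ↦ T ^ (15 / (3 + 5 * σ) * (1 - σ) + ε) := by
  have h4 : zetaFourthMomentWeak := zetaFourthMomentWeak_of_eq43 LFunctions.Bourgain2017_eq43_holds
  set η : ℝ := min (ε / 15) (1 / 100) with hηdef
  have hη0 : 0 < η := lt_min (by linarith) (by norm_num)
  have hη1 : η ≤ 1 / 100 := min_le_right _ _
  have hηε : 15 * η ≤ ε := by linarith [min_le_left (ε / 15) (1 / 100)]
  obtain ⟨U₀, C, hU₀, hC0, hws⟩ := GuthMaynardWindow.wellSpaced_gm h4 hLV hσ hσ1 hη0 hη1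
  obtain ⟨-, -, -, -, -, ⟨hk1, -⟩, -⟩ := GuthMaynardWindow.gm_exponents hσ hσ1
  obtain ⟨C', hC'0, hwsb⟩ := ZeroDensity.wellSpacedBound_of_eventually (by linarith) (by positivity)
    hU₀ hC0 hws
  obtain ⟨Cw, hCw0, hCw⟩ := LFunctions.exists_sum_zetaZeroWindow_le
  have hdy : ∀ U : ℝ, 1 ≤ U → (zetaZeroCountRe σ (2 * U) : ℝ) - zetaZeroCountRe σ U ≤
      (2 * C' * Cw) * U ^ (15 * (1 - σ) / (3 + 5 * σ) + 14 * η) * Real.log (2 * U + 3) := by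
    intro U hU
    have := ZeroDensity.count_dyadic_le (by linarith) hwsb hCw hU
    calc (zetaZeroCountRe σ (2 * U) : ℝ) - zetaZeroCountRe σ U
        ≤ 2 * C' * U ^ (15 * (1 - σ) / (3 + 5 * σ) + 14 * η) * (Cw * Real.log (2 * U + 3)) := this
      _ = (2 * C' * Cw) * U ^ (15 * (1 - σ) / (3 + 5 * σ) + 14 * η) * Real.log (2 * U + 3) := by
          ring
  have hbig := ZeroDensity.isBigO_of_dyadic (by positivity) (by positivity) hdy hη0
  refine hbig.trans (isBigO_rpow_rpow_atTop_of_le ?_)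
  have e : 15 * (1 - σ) / (3 + 5 * σ) = 15 / (3 + 5 * σ) * (1 - σ) := by ring
  linarith

/-- **`zeroDensity_guth_maynard` from Guth–Maynard's Theorem 1.1.** The named fact
`Literature.NumberTheory.LFunctions.zeroDensity_guth_maynard` (`N(σ, T) ≪_ε T^{15(1−σ)/(3+5σ)+ε}`
for `7/10 ≤ σ ≤ 1`, Guth–Maynard Theorem 1.2) follows from the large values estimate of their
Theorem 1.1 (hypothesis `hLV`, the theorem as printed, for `N ≤ T` and `T` large): on
`[7/10, 4/5]` by `isBigO_zetaZeroCountRe_window_of_largeValues` (§13.1 of the paper), on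
`[4/5, 1]` by Huxley's theorem `N(σ, T) ≪ T^{3(1−σ)/(3σ−1)+ε}` (PROVED in the tree,
`Ivic1985_theorem11_1_huxley_holds`) and `3/(3σ−1) ≤ 15/(3+5σ)` there
(`zeroDensity_guth_maynard_of_window`). What remains for an unconditional discharge of the fact
is exactly Theorem 1.1 of the paper (its §§3–12). [cite: GuthMaynard2026, Theorems 1.1, 1.2 and Section 13.1] -/
theorem zeroDensity_guth_maynard_of_largeValues
    (hLV : ∀ ε : ℝ, 0 < ε → ∃ C T₀ : ℝ, ∀ T : ℝ, T₀ ≤ T →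
      ∀ (N : ℕ) (b : ℕ → ℂ) (V : ℝ) (W : Finset ℝ), 1 ≤ N → (N : ℝ) ≤ T →
      (∀ n, ‖b n‖ ≤ 1) → 0 < V → (∀ t ∈ W, 0 ≤ t ∧ t ≤ T) →
      (∀ t ∈ W, ∀ t' ∈ W, t ≠ t' → 1 ≤ |t - t'|) →
      (∀ t ∈ W, V ≤ ‖∑ n ∈ Finset.Icc N (2 * N), b n * (n : ℂ) ^ ((t : ℂ) * I)‖) →
      (W.card : ℝ) ≤ C * T ^ ε * ((N : ℝ) ^ 2 * V⁻¹ ^ 2 + (N : ℝ) ^ (18 / 5 : ℝ) * V⁻¹ ^ 4 +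
        T * (N : ℝ) ^ (12 / 5 : ℝ) * V⁻¹ ^ 4)) :
    zeroDensity_guth_maynard :=
  zeroDensity_guth_maynard_of_window
    (fun _ε hε _σ hσ hσ1 ↦ isBigO_zetaZeroCountRe_window_of_largeValues hLV hε hσ hσ1)
    Ivic1985_theorem11_1_huxley_holds

/-- The same statement for Theorem 1.2 on the whole half-strip `1/2 ≤ σ ≤ 1` in the tree's form
`ZeroDensityEstimate (fun σ ↦ 15/(3+5σ)) (1/2)` (below `7/10` it is Ingham's theorem, PROVED in
the tree). [cite: GuthMaynard2026, Theorems 1.1, 1.2 and Section 13.1] -/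
theorem zeroDensityEstimate_guth_maynard_half_of_largeValues
    (hLV : ∀ ε : ℝ, 0 < ε → ∃ C T₀ : ℝ, ∀ T : ℝ, T₀ ≤ T →
      ∀ (N : ℕ) (b : ℕ → ℂ) (V : ℝ) (W : Finset ℝ), 1 ≤ N → (N : ℝ) ≤ T →
      (∀ n, ‖b n‖ ≤ 1) → 0 < V → (∀ t ∈ W, 0 ≤ t ∧ t ≤ T) →
      (∀ t ∈ W, ∀ t' ∈ W, t ≠ t' → 1 ≤ |t - t'|) →
      (∀ t ∈ W, V ≤ ‖∑ n ∈ Finset.Icc N (2 * N), b n * (n : ℂ) ^ ((t : ℂ) * I)‖) →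
      (W.card : ℝ) ≤ C * T ^ ε * ((N : ℝ) ^ 2 * V⁻¹ ^ 2 + (N : ℝ) ^ (18 / 5 : ℝ) * V⁻¹ ^ 4 +
        T * (N : ℝ) ^ (12 / 5 : ℝ) * V⁻¹ ^ 4)) :
    ZeroDensityEstimate (fun σ ↦ 15 / (3 + 5 * σ)) (1 / 2) :=
  zeroDensityEstimate_guth_maynard_half_iff.2 (zeroDensity_guth_maynard_of_largeValues hLV)

end Literature.NumberTheory.LFunctions

end
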